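import Literature.AlgebraicGeometry.Motives.HodgeThetaSubalgebraUnitaryTwoOddCore
import HarnessLib

/-!
# The `Θ`-subalgebra theorem for unitary multiplicities `(3, b)`, `3 ∤ b` — complex Hermitian core: an irreducible bracket-closed `𝔊 ∋ Θ`, stable under the adjoint of a Hermitian form definite on the two `Θ`-eigenspaces (dimensions `3` and `b`, `3 ∤ b`), is `End(W)` (Ribet 1983 Thm. 3 at multiplicities `(3, n−3)`, Lie step, classification-free)

Family `hodge`, layer `Literature/AlgebraicGeometry/Motives` (pure complex linear algebra; no geometry). Research context:
cell `pub-hodge-ring2` (HONEST FRAMING: research route conditional on HC_CM; not a corollary; Q11.4-sentence-2 already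
refuted in dim ≥ 3), Literature lane (lit gen 83, programme R62). UNCONDITIONAL; theorems only — no definition, no named
fact (D-0026), no `sorry`. It continues the tree's `(2, b)`, `b` odd, core `UnitaryTwoOdd.eq_top`
(`Motives/HodgeThetaSubalgebraUnitaryTwoOddCore`, lit gen 83) to the next coprime family `(3, b)`, `3 ∤ b`, in the same
Hermitian setting (the form `h(x, y) = i·ψ_ℂ(x, conj y)` of the polarization, Deligne LNM 900 I §3).

THE PRINT. K. A. Ribet, Amer. J. Math. 105 (1983), Thm. 3 (Gordon's survey, Thm. 6.3 (3) and pp. 18–19: «`End⁰(A) = K`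
imaginary quadratic, multiplicities `n'`, `n''` relatively prime ⟹ `Hg(A) = U_K(V,ψ)` … the induced map `MT(A, ℂ) → GL(W')`
is surjective … it is here that the relative primality of `n'` and `n''` is required» — Serre's Lie-algebra lemma). Here
`(n', n'') = (3, b)` or `(b, 3)` with `3 ∤ b`; for `dim A = 7` these are the signatures `(3,4)/(4,3)`, the last type-IV(1)
sevenfolds not covered by the tree.

SETTING (as in `UnitaryTwoOddCore`). `W` finite-dimensional complex; `𝔊 ⊆ End(W)` a subspace closed under the commutator,
acting irreducibly; `Θ ∈ 𝔊` an involution, `P = {Θ = 1}`, `Q = {Θ = −1}`; raising `B` (`ΘB = B = −BΘ`), lowering `C`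
(`ΘC = −C = −CΘ`); Hermitian data `s : W → W → ℂ` (left-additive, Hermitian, `P ⊥ Q`, `s(x,x) ≠ 0` on `P ∖ 0` and on
`Q ∖ 0`, adjoints exist in `𝔊`).

WHAT IS PROVED (architecture: Ribet's/Serre's «surjectivity onto `GL(W)`», the minuscule-weight classification replaced by
the Euclid-type induction `(3, b) → (3, b − 3)` of the `(2, b)` file, plus ONE new ingredient, the rank-three raising lemma).
* §1 **`UnitaryThreeCoprime.eq_top_of_finrank_eq_one`** — the `(m, 1)` core, `m ≥ 2`, WITHOUT Hermitian data: `Q = ℂq₀`,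
  every raising operator is `ψ₀ ⊗ p` (`ψ₀` the `q₀`-coordinate of the `Q`-component), every lowering one is `ψ ⊗ q₀` with
  `ψ(Q) = 0`; by the two covering facts the `p` exhaust `P` and the `ψ` exhaust the annihilator of `Q` (dimension count
  through the evaluation map `P → (Q⁰)^*`); `[ψ₀ ⊗ p, ψ ⊗ q₀] = ψ ⊗ p − ψ(p)·π_Q`, and
  `(m−1)⁻¹Θ + (ψ ⊗ u − π_Q) − (m−1)⁻¹ Σⱼ (ψⱼ ⊗ eⱼ − π_Q) = ψ ⊗ u` (`Σⱼ ψⱼ ⊗ eⱼ = π_P`, `ψ(u) = 1`) is a rank-one idempotent.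
* §2 **`UnitaryThreeCoprime.exists_raise_rank_ge_two`** — `dim P ≥ 2`, `dim Q ≥ 2` ⟹ a raising operator of rank `≥ 2`
  (the rank-`≤ 1` argument of `UnitaryTwoOdd.exists_raise_onto`).
* §3 **`UnitaryThreeCoprime.exists_projector_pair`** — for ANY raising `B ∈ 𝔊` with adjoint `C`, the Cayley–Hamilton
  element `D = δ⁻¹(χ(CB) − χ(BC)) ∈ 𝔊` (`χ` the characteristic polynomial of `BC` on `B(W)`) is `+1` on `P₁ = B(W)`, `0` on
  `P₀ = P ∩ ker C`, `−1` on `Q₁ = C(P)`, `0` on `Q₀ = Q ∩ ker B`, `W = P₁ ⊕ P₀ ⊕ Q₁ ⊕ Q₀` with the four pieces pairwise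
  `s`-orthogonal (positivity: `BCp = 0 ⟹ Cp = 0`), `D` commutes with `Θ` and is `s`-self-adjoint.
* §4 **`UnitaryThreeCoprime.levi_instance`** — for two commuting involutions `Θ₁, Θ₂ ∈ 𝔊`, `Θ₁` self-adjoint, the
  restrictions of the `Θ₁`-commuting elements of `𝔊` to `U = {Θ₁ = −1}` form a bracket-closed, irreducible
  (`UnitaryTwoOdd.levi_irreducible`), adjoint-closed algebra containing the involution `Θ₂|_U`; so any core theorem for the
  multiplicities of `Θ₂|_U` makes it ALL of `End(U)`.
* §5 **`UnitaryThreeCoprime.exists_raise_onto_three`** — THE RANK-THREE RAISING LEMMA: `dim P = 3`, `dim Q ≥ 4` ⟹ some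
  raising operator maps onto `P`. If not, a raising `B` of rank `2` (§2) is of maximal rank; with `D` of §3,
  (★) every raising `B'` maps `Q₀` into `P₁` (else `B + ½([D,[D,B']] − 3[D,B'] + 2B')` is onto `P`), and, applied to
  `[[B',C],B'']`, (♣) `B'CB''q + B''CB'q ∈ P₁` for `q ∈ Q₀`. The involution `Θ' = 2D − Θ ∈ 𝔊` has `{Θ' = −1} = P₀ ⊕ Q₁`
  of `Θ`-multiplicities `(1, 2)`, so §4 with `UnitaryTwoOdd.eq_top'` yields `Z₁, Z₂ ∈ 𝔊` whose raising parts `B₁, B₂`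
  satisfy `Bⱼ(Ceₖ) = δⱼₖ η` (`P₀ = ℂη`, `e` a basis of `P₁`); (♣) forces every raising `B'` to agree on `Q₀` with
  `c₁B₁ + c₂B₂`, and `q ↦ e₁^*(B₂ q)`-type coordinates to be alternating, whence a non-zero `q ∈ Q₀` (`dim Q₀ ≥ 2`)
  killed by all raising operators — contradicting the covering fact `UnitaryThetaCore.eq_zero_of_forall_raise_apply_eq_zero`.
* §6 **`UnitaryThreeCoprime.eq_top`** — THE THEOREM: `dim P = 3`, `3 ∤ dim Q` ⟹ `𝔊 = End(W)`, by strong induction on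
  `b = dim Q`: `b = 1` is §1, `b = 2` is `UnitaryTwoOdd.eq_top'`, and for `b ≥ 4` the rank-three raising operator and its
  adjoint are a full-rank pair, `UnitaryTwoOdd.exists_idempotent_of_fullRank_pair` gives `E`, the Levi algebra
  `𝔩_Q ∋ 1_Q − 2E|_Q` (multiplicities `(3, b − 3)`, built exactly as in `UnitaryTwoOdd.eq_top`) is `End(Q)` by the
  induction hypothesis, and the `𝔑`-trick of the `(2,b)` file yields a rank-one idempotent;
  **`UnitaryThreeCoprime.eq_top'`** is the symmetric statement (`3 ∤ dim P`, `dim Q = 3`).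

## References
* [Ribet1983] K. A. Ribet, *Hodge classes on certain types of abelian varieties*, Amer. J. Math. 105 (1983), Thm. 3.
* [Gordon1997] B. B. Gordon, *A survey of the Hodge conjecture for abelian varieties*, Thm. 6.3 (3) and pp. 18–19.
* [Deligne1982HodgeCycles] P. Deligne, *Hodge cycles on abelian varieties*, LNM 900 (1982), I §3 (Prop. 3.4, 3.6).
* [MoonenZarhin1999LowDim] B. Moonen, Yu. Zarhin, Math. Ann. 315 (1999), §2 (2.4) and Thm. (2.7).
* [GoodmanWallachGTM255] R. Goodman, N. Wallach, *Symmetry, Representations, and Invariants*, §4.1.1 (gradings).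
* [Humphreys1972] J. E. Humphreys, *Introduction to Lie Algebras and Representation Theory*, §19.1.
* [HoffmanKunze1971LinearAlgebra] K. Hoffman, R. Kunze, *Linear Algebra*, §3.5–§3.7 (dual space, annihilators),
  §6.7 (projections of a direct sum), §8.5, §9.5 (adjoints, positive operators).
-/

noncomputable section

open Module Polynomial

namespace Literature.AlgebraicGeometry.Motives

namespace HodgeStructure

/-! ### §1 The `(m, 1)` core (no Hermitian data) -/

section RankOneQ

variable {W : Type*} [AddCommGroup W] [Module ℂ W]

/-- **The `(m, 1)` core, `m ≥ 2`.** Let `𝔊 ⊆ End(W)` be bracket-closed and irreducible, `Θ ∈ 𝔊` an involution with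
eigenspaces `P` (`dim P ≥ 2`) and `Q` (`dim Q = 1`). Then `𝔊 = End(W)`: with `Q = ℂq₀`, raising operators are `ψ₀ ⊗ p`
and (covering) every `p ∈ P` occurs; lowering operators are `ψ ⊗ q₀` and (covering, dimension count) every functional
`ψ` killing `Q` occurs; `[ψ₀ ⊗ p, ψ ⊗ q₀] = ψ ⊗ p − ψ(p)π_Q`, and a suitable combination with `Θ` is a rank-one idempotent.
(Ribet's Theorem 3 at `min(n', n'') = 1`, Lie step; the tree's `Motives/HodgeThetaSubalgebraUnitary` proves the same
statement inside `𝔲_K(V, ψ)`; this is the abstract form used by the `(3, b)` induction at `b ≡ 1 (mod 3)`.)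
[cite: Ribet1983, Thm. 3] [cite: Gordon1997, Thm. 6.3 (3) and pp. 18–19] [cite: MoonenZarhin1999LowDim, §2 (2.4)]
[cite: HoffmanKunze1971LinearAlgebra, §3.5–§3.7] -/
theorem UnitaryThreeCoprime.eq_top_of_finrank_eq_one [FiniteDimensional ℂ W] {𝔊 : Submodule ℂ (Module.End ℂ W)}
    (hbr : ∀ Y ∈ 𝔊, ∀ Z ∈ 𝔊, Y * Z - Z * Y ∈ 𝔊)
    (hirr : ∀ U : Submodule ℂ W, (∀ A ∈ 𝔊, ∀ u ∈ U, A u ∈ U) → U = ⊥ ∨ U = ⊤)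
    {Θ : Module.End ℂ W} (hΘ : Θ ∈ 𝔊) (hΘΘ : Θ * Θ = 1)
    {P Q : Submodule ℂ W} (hP : ∀ x, x ∈ P ↔ Θ x = x) (hQ : ∀ x, x ∈ Q ↔ Θ x = -x)
    (hP2 : 2 ≤ Module.finrank ℂ P) (hQ1 : Module.finrank ℂ Q = 1) : 𝔊 = ⊤ := by
  classical
  have hΘΘv : ∀ v, Θ (Θ v) = v := fun v => by rw [← Module.End.mul_apply, hΘΘ, Module.End.one_apply]
  have hPhat : ∀ w, (2 : ℂ)⁻¹ • (w + Θ w) ∈ P := fun w => (hP _).2 (by rw [map_smul, map_add, hΘΘv, add_comm])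
  have hQhat : ∀ w, (2 : ℂ)⁻¹ • (w - Θ w) ∈ Q := fun w =>
    (hQ _).2 (by rw [map_smul, map_sub, hΘΘv, ← smul_neg, neg_sub])
  have hsplit : ∀ w, (2 : ℂ)⁻¹ • (w + Θ w) + (2 : ℂ)⁻¹ • (w - Θ w) = w := fun w => by module
  have hPQinf : P ⊓ Q = ⊥ := by
    rw [eq_bot_iff]
    intro x hx
    rw [Submodule.mem_bot]
    have h1 := (hP x).1 hx.1
    rw [(hQ x).1 hx.2, neg_eq_iff_add_eq_zero, ← two_smul ℂ x, smul_eq_zero] at h1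
    exact h1.resolve_left (two_ne_zero' ℂ)
  have hPQsup : P ⊔ Q = ⊤ := by
    rw [eq_top_iff]
    intro v _
    rw [← hsplit v]
    exact Submodule.add_mem_sup (hPhat v) (hQhat v)
  have hdimW : Module.finrank ℂ W = Module.finrank ℂ P + Module.finrank ℂ Q := by
    have h := Submodule.finrank_sup_add_finrank_inf_eq P Q
    rw [hPQsup, hPQinf, finrank_top, finrank_bot, add_zero] at h
    exact h
  have hraiseP : ∀ Z : Module.End ℂ W, Z * Θ = -Z → ∀ p ∈ P, Z p = 0 := fun Z hZΘ p hp => by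
    have h : Z p = -(Z p) := by
      conv_lhs => rw [← (hP p).1 hp]
      rw [← Module.End.mul_apply, hZΘ, LinearMap.neg_apply]
    have h2 : (2 : ℂ) • Z p = 0 := by rw [two_smul]; nth_rewrite 2 [h]; rw [add_neg_cancel]
    exact (smul_eq_zero.1 h2).resolve_left two_ne_zero
  have hlowerQ : ∀ Z : Module.End ℂ W, Z * Θ = Z → ∀ q ∈ Q, Z q = 0 := fun Z hZΘ q hq => by
    have h : Z q = -(Z q) := by
      conv_lhs => rw [← neg_neg q, ← (hQ q).1 hq, map_neg, ← Module.End.mul_apply, hZΘ]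
    have h2 : (2 : ℂ) • Z q = 0 := by rw [two_smul]; nth_rewrite 2 [h]; rw [add_neg_cancel]
    exact (smul_eq_zero.1 h2).resolve_left two_ne_zero
  have hlowerval : ∀ Z : Module.End ℂ W, Θ * Z = -Z → ∀ w, Z w ∈ Q := fun Z hΘZ w =>
    (hQ _).2 (by rw [← Module.End.mul_apply, hΘZ, LinearMap.neg_apply])
  -- `Q = ℂ q₀`
  obtain ⟨⟨q₀, hq₀Q⟩, hq₀0⟩ := Module.finrank_pos_iff_exists_ne_zero.1 (show 0 < Module.finrank ℂ Q by omega)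
  have hq₀0' : q₀ ≠ 0 := fun h => hq₀0 (Subtype.ext h)
  have hq₀Θ : Θ q₀ = -q₀ := (hQ q₀).1 hq₀Q
  have hQeq : (ℂ ∙ q₀) = Q :=
    Submodule.eq_of_le_of_finrank_le ((Submodule.span_singleton_le_iff_mem q₀ Q).2 hq₀Q)
      (by rw [hQ1, finrank_span_singleton hq₀0'])
  have hP0 : ∃ p : W, p ≠ 0 ∧ Θ p = p := by
    obtain ⟨⟨p, hp⟩, hp0⟩ := Module.finrank_pos_iff_exists_ne_zero.1 (show 0 < Module.finrank ℂ P by omega)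
    exact ⟨p, fun h => hp0 (Subtype.ext h), (hP p).1 hp⟩
  have hQ0 : ∃ q : W, q ≠ 0 ∧ Θ q = -q := ⟨q₀, hq₀0', hq₀Θ⟩
  -- the coordinate functional `ψ₀` (`ψ₀(t q₀ + p) = t`)
  set i₀ : ℂ →ₗ[ℂ] W := LinearMap.toSpanSingleton ℂ W q₀ with hi₀def
  have hi₀inj : Function.Injective i₀ := LinearMap.ker_eq_bot.1 (LinearMap.ker_toSpanSingleton ℂ hq₀0')
  have hi₀range : LinearMap.range i₀ = Q := by rw [hi₀def, LinearMap.range_toSpanSingleton, hQeq]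
  have hcompl : IsCompl (LinearMap.range i₀) P := by
    rw [hi₀range]
    exact IsCompl.of_eq (by rw [inf_comm, hPQinf]) (by rw [sup_comm, hPQsup])
  set ψ₀ : Module.Dual ℂ W := LinearMap.linearProjOfIsCompl P i₀ hi₀inj hcompl with hψ₀def
  have hψ₀t : ∀ t : ℂ, ψ₀ (t • q₀) = t := fun t => by
    have h := LinearMap.linearProjOfIsCompl_apply_left P i₀ hi₀inj hcompl t
    rwa [show i₀ t = t • q₀ from rfl] at h
  have hψ₀P : ∀ p ∈ P, ψ₀ p = 0 := fun p hp => LinearMap.linearProjOfIsCompl_apply_right' P i₀ hi₀inj hcompl p hp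
  have hQrep : ∀ y ∈ Q, ψ₀ y • q₀ = y := fun y hy => by
    have hy' : y ∈ ℂ ∙ q₀ := by rw [hQeq]; exact hy
    obtain ⟨t, rfl⟩ := Submodule.mem_span_singleton.1 hy'
    rw [hψ₀t]
  have hψ₀q₀ : ψ₀ q₀ = 1 := by have h := hψ₀t 1; rwa [one_smul] at h
  have hψ₀w : ∀ w, ψ₀ w • q₀ = (2 : ℂ)⁻¹ • (w - Θ w) := fun w => by
    conv_lhs => rw [← hsplit w, map_add, hψ₀P _ (hPhat w), zero_add]
    exact hQrep _ (hQhat w)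
  -- the operator `π_Q = ψ₀ ⊗ q₀ = ½(1 − Θ)`
  have hπQ : ψ₀.smulRight q₀ = (2 : ℂ)⁻¹ • ((1 : Module.End ℂ W) - Θ) := by
    refine LinearMap.ext fun w => ?_
    rw [LinearMap.smulRight_apply, hψ₀w, LinearMap.smul_apply, LinearMap.sub_apply, Module.End.one_apply]
  -- raising operators are `ψ₀ ⊗ (B q₀)`
  have hBform : ∀ B : Module.End ℂ W, B * Θ = -B → ∀ w, B w = ψ₀ w • B q₀ := fun B hBΘ w => by
    have hψw : ψ₀ w = ψ₀ ((2 : ℂ)⁻¹ • (w - Θ w)) := by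
      conv_lhs => rw [← hsplit w, map_add, hψ₀P _ (hPhat w), zero_add]
    calc B w = B ((2 : ℂ)⁻¹ • (w + Θ w) + (2 : ℂ)⁻¹ • (w - Θ w)) := by rw [hsplit]
      _ = B ((2 : ℂ)⁻¹ • (w - Θ w)) := by rw [map_add, hraiseP B hBΘ _ (hPhat w), zero_add]
      _ = B (ψ₀ ((2 : ℂ)⁻¹ • (w - Θ w)) • q₀) := by rw [hQrep _ (hQhat w)]
      _ = ψ₀ w • B q₀ := by rw [map_smul, ← hψw]
  -- the bracket `[B, C] = ψ_C ⊗ p − ψ_C(p) π_Q`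
  have hbracket : ∀ B C : Module.End ℂ W, B * Θ = -B → Θ * C = -C →
      B * C - C * B = (ψ₀ ∘ₗ C).smulRight (B q₀) - (ψ₀ (C (B q₀))) • ψ₀.smulRight q₀ := by
    intro B C hBΘ hΘC
    refine LinearMap.ext fun w => ?_
    have h1 : B (C w) = ψ₀ (C w) • B q₀ := hBform B hBΘ (C w)
    have h2 : C (B w) = (ψ₀ w * ψ₀ (C (B q₀))) • q₀ := by
      rw [hBform B hBΘ w, map_smul]
      conv_lhs => rw [← hQrep _ (hlowerval C hΘC (B q₀))]
      rw [smul_smul]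
    rw [LinearMap.sub_apply, Module.End.mul_apply, Module.End.mul_apply, h1, h2, LinearMap.sub_apply,
      LinearMap.smulRight_apply, LinearMap.comp_apply, LinearMap.smul_apply, LinearMap.smulRight_apply, smul_smul,
      mul_comm]
  -- covering (a): every `p ∈ P` is `B q₀` for a raising `B ∈ 𝔊`
  have hsurjP : ∀ p ∈ P, ∃ B ∈ 𝔊, Θ * B = B ∧ B * Θ = -B ∧ B q₀ = p := by
    intro p hp
    have hspan := UnitaryThetaCore.mem_span_raise_apply hbr hirr hΘ hΘΘ hQ0 ((hP p).1 hp)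
    clear hp
    induction hspan using Submodule.span_induction with
    | mem x hx =>
      obtain ⟨B, hB, hΘB, hBΘ, w, rfl⟩ := hx
      refine ⟨ψ₀ w • B, Submodule.smul_mem _ _ hB, by rw [mul_smul_comm, hΘB], by rw [smul_mul_assoc, hBΘ, smul_neg],
        ?_⟩
      rw [LinearMap.smul_apply, ← hBform B hBΘ w]
    | zero => exact ⟨0, Submodule.zero_mem _, by rw [mul_zero], by rw [zero_mul, neg_zero], rfl⟩
    | add x y _ _ hx hy =>
      obtain ⟨B, hB, h1, h2, hBx⟩ := hx
      obtain ⟨B', hB', h1', h2', hBy⟩ := hy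
      exact ⟨B + B', Submodule.add_mem _ hB hB', by rw [mul_add, h1, h1'], by rw [add_mul, h2, h2', neg_add],
        by rw [LinearMap.add_apply, hBx, hBy]⟩
    | smul c x _ hx =>
      obtain ⟨B, hB, h1, h2, hBx⟩ := hx
      exact ⟨c • B, Submodule.smul_mem _ c hB, by rw [mul_smul_comm, h1], by rw [smul_mul_assoc, h2, smul_neg],
        by rw [LinearMap.smul_apply, hBx]⟩
  -- covering (b): every functional killing `Q` is `ψ₀ ∘ C` for a lowering `C ∈ 𝔊`
  set L : Submodule ℂ (Module.Dual ℂ W) :=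
    { carrier := {ψ | ∃ C ∈ 𝔊, Θ * C = -C ∧ C * Θ = C ∧ ψ = ψ₀ ∘ₗ C}
      zero_mem' := ⟨0, Submodule.zero_mem _, by rw [mul_zero, neg_zero], by rw [zero_mul], by rw [LinearMap.comp_zero]⟩
      add_mem' := by
        rintro ψ ψ' ⟨C, hC, h1, h2, rfl⟩ ⟨C', hC', h1', h2', rfl⟩
        exact ⟨C + C', Submodule.add_mem _ hC hC', by rw [mul_add, h1, h1', neg_add], by rw [add_mul, h2, h2'],
          by rw [LinearMap.comp_add]⟩
      smul_mem' := by
        rintro c ψ ⟨C, hC, h1, h2, rfl⟩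
        exact ⟨c • C, Submodule.smul_mem _ c hC, by rw [mul_smul_comm, h1, smul_neg], by rw [smul_mul_assoc, h2],
          by rw [LinearMap.comp_smul]⟩ } with hLdef
  have hmemL : ∀ ψ, ψ ∈ L ↔ ∃ C ∈ 𝔊, Θ * C = -C ∧ C * Θ = C ∧ ψ = ψ₀ ∘ₗ C := fun ψ => Iff.rfl
  have hLle : L ≤ Q.dualAnnihilator := by
    rintro ψ ⟨C, -, -, hCΘ, rfl⟩
    rw [Submodule.mem_dualAnnihilator]
    intro q hq
    rw [LinearMap.comp_apply, hlowerQ C hCΘ q hq, map_zero]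
  have hLeq : L = Q.dualAnnihilator := by
    refine Submodule.eq_of_le_of_finrank_le hLle ?_
    -- `dim Q⁰ = dim W − 1 = dim P ≤ dim L` through the injective evaluation `P → L^*`
    have hann : Module.finrank ℂ Q.dualAnnihilator = Module.finrank ℂ P := by
      have h := Subspace.finrank_add_finrank_dualAnnihilator_eq Q
      omega
    rw [hann]
    set ev : P →ₗ[ℂ] Module.Dual ℂ L :=
      { toFun := fun p =>
          { toFun := fun ψ => (ψ : Module.Dual ℂ W) (p : W)
            map_add' := fun ψ ψ' => by rw [Submodule.coe_add, LinearMap.add_apply]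
            map_smul' := fun c ψ => by rw [Submodule.coe_smul, LinearMap.smul_apply, RingHom.id_apply] }
        map_add' := fun p p' => by ext ψ; simp
        map_smul' := fun c p => by ext ψ; simp } with hevdef
    have hevinj : Function.Injective ev := by
      rw [← LinearMap.ker_eq_bot, eq_bot_iff]
      intro p hp
      rw [LinearMap.mem_ker] at hp
      rw [Submodule.mem_bot]
      apply Subtype.ext
      have hkill : ∀ C ∈ 𝔊, Θ * C = -C → C * Θ = C → C (p : W) = 0 := by
        intro C hC h1 h2
        have hψ : ψ₀ (C (p : W)) = 0 := by
          have h := congrArg (fun f : Module.Dual ℂ L => f ⟨ψ₀ ∘ₗ C, (hmemL _).2 ⟨C, hC, h1, h2, rfl⟩⟩) hp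
          simpa [hevdef] using h
        rw [← hQrep _ (hlowerval C h1 p), hψ, zero_smul]
      have hnΘ : -Θ ∈ 𝔊 := Submodule.neg_mem _ hΘ
      have hnΘΘ : (-Θ) * (-Θ) = 1 := by rw [neg_mul_neg, hΘΘ]
      refine UnitaryThetaCore.eq_zero_of_forall_raise_apply_eq_zero hbr hirr hnΘ hnΘΘ
        ⟨q₀, hq₀0', by rw [LinearMap.neg_apply, hq₀Θ, neg_neg]⟩
        (by rw [LinearMap.neg_apply, (hP _).1 p.2]) fun C hC h1 h2 => hkill C hC ?_ ?_
      · rw [neg_mul, neg_eq_iff_eq_neg] at h1; exact h1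
      · rw [mul_neg, neg_inj] at h2; exact h2
    have h := LinearMap.finrank_le_finrank_of_injective hevinj
    rwa [Subspace.dual_finrank_eq] at h
  have hsurjL : ∀ ψ : Module.Dual ℂ W, (∀ q ∈ Q, ψ q = 0) →
      ∃ C ∈ 𝔊, Θ * C = -C ∧ C * Θ = C ∧ ψ = ψ₀ ∘ₗ C := fun ψ hψ =>
    (hmemL ψ).1 (by rw [hLeq, Submodule.mem_dualAnnihilator]; exact hψ)
  -- the elements `T(p, ψ) = ψ ⊗ p − ψ(p) π_Q ∈ 𝔊`
  have hT : ∀ p ∈ P, ∀ ψ : Module.Dual ℂ W, (∀ q ∈ Q, ψ q = 0) →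
      ψ.smulRight p - ψ p • ψ₀.smulRight q₀ ∈ 𝔊 := by
    intro p hp ψ hψ
    obtain ⟨B, hB, hΘB, hBΘ, hBq₀⟩ := hsurjP p hp
    obtain ⟨C, hC, hΘC, hCΘ, rfl⟩ := hsurjL ψ hψ
    have h := hbr B hB C hC
    rw [hbracket B C hBΘ hΘC, hBq₀] at h
    exact h
  -- a basis of `P` and the functionals `ψⱼ = eⱼ^* ∘ π_P`
  set m := Module.finrank ℂ P with hmdef
  set e := Module.finBasis ℂ P with hedef
  set πP : W →ₗ[ℂ] P := LinearMap.codRestrict P ((2 : ℂ)⁻¹ • ((1 : Module.End ℂ W) + Θ)) fun w => by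
    rw [LinearMap.smul_apply, LinearMap.add_apply, Module.End.one_apply]; exact hPhat w with hπPdef
  have hπPapply : ∀ w, (πP w : W) = (2 : ℂ)⁻¹ • (w + Θ w) := fun w => rfl
  have hπPp : ∀ p : P, πP p = p := fun p => Subtype.ext (by
    rw [hπPapply, (hP _).1 p.2, ← two_smul ℂ (p : W), smul_smul, inv_mul_cancel₀ two_ne_zero, one_smul])
  have hπPq : ∀ q ∈ Q, πP q = 0 := fun q hq => Subtype.ext (by
    rw [hπPapply, (hQ q).1 hq, add_neg_cancel, smul_zero, Submodule.coe_zero])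
  set ψ_ : Fin m → Module.Dual ℂ W := fun j => (e.coord j) ∘ₗ πP with hψ_def
  have hψ_Q : ∀ j, ∀ q ∈ Q, ψ_ j q = 0 := fun j q hq => by
    rw [hψ_def]; dsimp only; rw [LinearMap.comp_apply, hπPq q hq, map_zero]
  have hψ_e : ∀ j, ψ_ j (e j : W) = 1 := fun j => by
    rw [hψ_def]; dsimp only
    rw [LinearMap.comp_apply, hπPp, Module.Basis.coord_apply, Module.Basis.repr_self, Finsupp.single_eq_same]
  have hsumP : ∑ j, (ψ_ j).smulRight (e j : W) = (2 : ℂ)⁻¹ • ((1 : Module.End ℂ W) + Θ) := by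
    refine LinearMap.ext fun w => ?_
    rw [LinearMap.sum_apply, LinearMap.smul_apply, LinearMap.add_apply, Module.End.one_apply, ← hπPapply]
    simp only [LinearMap.smulRight_apply, hψ_def, LinearMap.comp_apply, Module.Basis.coord_apply]
    have h := congrArg Subtype.val (e.sum_repr (πP w))
    simpa only [Submodule.coe_sum, Submodule.coe_smul] using h
  -- the rank-one idempotent
  have hm1 : ((m : ℂ) - 1) ≠ 0 := by
    rw [sub_ne_zero]; exact_mod_cast (show m ≠ 1 by omega)
  set α : ℂ := ((m : ℂ) - 1)⁻¹ with hαdef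
  have hα : α * ((m : ℂ) - 1) = 1 := inv_mul_cancel₀ hm1
  set j₀ : Fin m := ⟨0, by omega⟩ with hj₀def
  set u : W := (e j₀ : W) with hudef
  have huP : u ∈ P := (e j₀).2
  set Z : Module.End ℂ W := α • Θ + ((ψ_ j₀).smulRight u - (ψ_ j₀) u • ψ₀.smulRight q₀) -
    α • ∑ j, ((ψ_ j).smulRight (e j : W) - (ψ_ j) (e j : W) • ψ₀.smulRight q₀) with hZdef
  have hZmem : Z ∈ 𝔊 :=
    Submodule.sub_mem _ (Submodule.add_mem _ (Submodule.smul_mem _ _ hΘ) (hT u huP _ (hψ_Q j₀)))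
      (Submodule.smul_mem _ _ (Submodule.sum_mem _ fun j _ => hT _ (e j).2 _ (hψ_Q j)))
  have hΘeq : Θ = (1 : Module.End ℂ W) - (2 : ℂ) • ψ₀.smulRight q₀ := by rw [hπQ]; module
  have hZeq : Z = (ψ_ j₀).smulRight u := by
    have hsum' : ∑ j, ((ψ_ j).smulRight (e j : W) - (ψ_ j) (e j : W) • ψ₀.smulRight q₀) =
        (2 : ℂ)⁻¹ • ((1 : Module.End ℂ W) + Θ) - (m : ℂ) • ψ₀.smulRight q₀ := by
      rw [Finset.sum_sub_distrib, hsumP]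
      simp only [hψ_e, one_smul, Finset.sum_const, Finset.card_univ, Fintype.card_fin, ← Nat.cast_smul_eq_nsmul ℂ]
    rw [hZdef, hsum', hψ_e, one_smul]
    have hcoef : α * (m : ℂ) - α - 1 = 0 := by linear_combination hα
    have hfin : α • Θ + ((ψ_ j₀).smulRight u - ψ₀.smulRight q₀) -
        α • ((2 : ℂ)⁻¹ • ((1 : Module.End ℂ W) + Θ) - (m : ℂ) • ψ₀.smulRight q₀) =
        (ψ_ j₀).smulRight u + (α * (m : ℂ) - α - 1) • ψ₀.smulRight q₀ := by
      rw [hΘeq]; module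
    rw [hfin, hcoef, zero_smul, add_zero]
  have he : (ψ_ j₀).smulRight u ∈ 𝔊 := hZeq ▸ hZmem
  exact UnitaryTwoOdd.eq_top_of_rankOne hbr hirr (hψ_e j₀) he

end RankOneQ

/-! ### §2 A raising operator of rank at least two -/

section RankTwo

variable {W : Type*} [AddCommGroup W] [Module ℂ W]

/-- **An irreducible `𝔊 ∋ Θ` with `dim P ≥ 2`, `dim Q ≥ 2` has a raising operator of rank `≥ 2`.** Otherwise every raising
operator has rank `≤ 1`; two of them with independent image lines have a common kernel
(`UnitaryTwoOdd.apply_eq_zero_of_rank_le_one`), so ALL raising operators kill one hyperplane `H ⊇ P`, and `H ∩ Q ≠ 0`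
contradicts the covering fact `UnitaryThetaCore.eq_zero_of_forall_raise_apply_eq_zero` (verbatim the argument of
`UnitaryTwoOdd.exists_raise_onto`). [cite: Gordon1997, §6 (proof of Thm. 6.3.3, p. 19)] [cite: Ribet1983, Thm. 3] -/
theorem UnitaryThreeCoprime.exists_raise_rank_ge_two [FiniteDimensional ℂ W] {𝔊 : Submodule ℂ (Module.End ℂ W)}
    (hbr : ∀ Y ∈ 𝔊, ∀ Z ∈ 𝔊, Y * Z - Z * Y ∈ 𝔊)
    (hirr : ∀ U : Submodule ℂ W, (∀ A ∈ 𝔊, ∀ u ∈ U, A u ∈ U) → U = ⊥ ∨ U = ⊤)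
    {Θ : Module.End ℂ W} (hΘ : Θ ∈ 𝔊) (hΘΘ : Θ * Θ = 1)
    {P Q : Submodule ℂ W} (hP : ∀ x, x ∈ P ↔ Θ x = x) (hQ : ∀ x, x ∈ Q ↔ Θ x = -x)
    (hP2 : 2 ≤ Module.finrank ℂ P) (hQ2 : 2 ≤ Module.finrank ℂ Q) :
    ∃ B ∈ 𝔊, Θ * B = B ∧ B * Θ = -B ∧ 2 ≤ Module.finrank ℂ (LinearMap.range B) := by
  classical
  have hΘΘv : ∀ v, Θ (Θ v) = v := fun v => by rw [← Module.End.mul_apply, hΘΘ, Module.End.one_apply]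
  have hP0 : ∃ p : W, p ≠ 0 ∧ Θ p = p := by
    have hpos : 0 < Module.finrank ℂ P := by omega
    obtain ⟨⟨p, hp⟩, hp0⟩ := Module.finrank_pos_iff_exists_ne_zero.1 hpos
    exact ⟨p, fun h => hp0 (Subtype.ext h), (hP p).1 hp⟩
  have hQ0 : ∃ q : W, q ≠ 0 ∧ Θ q = -q := by
    have hpos : 0 < Module.finrank ℂ Q := by omega
    obtain ⟨⟨q, hq⟩, hq0⟩ := Module.finrank_pos_iff_exists_ne_zero.1 hpos
    exact ⟨q, fun h => hq0 (Subtype.ext h), (hQ q).1 hq⟩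
  by_contra hcon
  push Not at hcon
  have hrank : ∀ B ∈ 𝔊, Θ * B = B → B * Θ = -B → Module.finrank ℂ (LinearMap.range B) ≤ 1 := fun B hB hΘB hBΘ => by
    have := hcon B hB hΘB hBΘ; omega
  have hline : ∀ B ∈ 𝔊, Θ * B = B → B * Θ = -B → ∀ w₀, B w₀ ≠ 0 → ∀ w, B w ∈ ℂ ∙ B w₀ :=
    fun B hB hΘB hBΘ w₀ hw₀ w => UnitaryTwoOdd.mem_span_of_finrank_le_one (hrank B hB hΘB hBΘ)
      (LinearMap.mem_range_self B w₀) (LinearMap.mem_range_self B w) hw₀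
  have hadd : ∀ B B', Θ * B = B → B * Θ = -B → Θ * B' = B' → B' * Θ = -B' →
      Θ * (B + B') = B + B' ∧ (B + B') * Θ = -(B + B') := fun B B' h1 h2 h3 h4 =>
    ⟨by rw [mul_add, h1, h3], by rw [add_mul, h2, h4, neg_add]⟩
  set S : Set W := {x : W | ∃ B ∈ 𝔊, Θ * B = B ∧ B * Θ = -B ∧ ∃ w, B w = x} with hSdef
  have hspan : ∀ y, Θ y = y → y ∈ Submodule.span ℂ S := fun y hy =>
    UnitaryThetaCore.mem_span_raise_apply hbr hirr hΘ hΘΘ hQ0 hy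
  obtain ⟨B₁, hB₁, hΘB₁, hB₁Θ, w₁, hw₁⟩ : ∃ B₁ ∈ 𝔊, Θ * B₁ = B₁ ∧ B₁ * Θ = -B₁ ∧ ∃ w₁, B₁ w₁ ≠ 0 := by
    by_contra hne
    push Not at hne
    obtain ⟨p, hp0, hp⟩ := hP0
    have hS0 : Submodule.span ℂ S ≤ ⊥ := by
      rw [Submodule.span_le]
      rintro x ⟨B, hB, h1, h2, w, rfl⟩
      exact hne B hB h1 h2 w
    exact hp0 ((Submodule.mem_bot ℂ).1 (hS0 (hspan p hp)))
  set x₁ := B₁ w₁ with hx₁def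
  obtain ⟨B₂, hB₂, hΘB₂, hB₂Θ, w₂, hw₂⟩ : ∃ B₂ ∈ 𝔊, Θ * B₂ = B₂ ∧ B₂ * Θ = -B₂ ∧ ∃ w₂, B₂ w₂ ∉ ℂ ∙ x₁ := by
    by_contra hne
    push Not at hne
    have hS1 : Submodule.span ℂ S ≤ ℂ ∙ x₁ := by
      rw [Submodule.span_le]
      rintro x ⟨B, hB, h1, h2, w, rfl⟩
      exact hne B hB h1 h2 w
    have hPle : P ≤ ℂ ∙ x₁ := fun p hp => hS1 (hspan p ((hP p).1 hp))
    have h := Submodule.finrank_mono hPle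
    rw [finrank_span_singleton hw₁] at h
    omega
  set x₂ := B₂ w₂ with hx₂def
  have hx₂0 : x₂ ≠ 0 := fun h => hw₂ (by rw [h]; exact Submodule.zero_mem _)
  have hx₁2 : x₁ ∉ ℂ ∙ x₂ := fun h => by
    obtain ⟨c, hc⟩ := Submodule.mem_span_singleton.1 h
    have hc0 : c ≠ 0 := fun h0 => hw₁ (by rw [← hc, h0, zero_smul])
    exact hw₂ (Submodule.mem_span_singleton.2 ⟨c⁻¹, by rw [← hc, smul_smul, inv_mul_cancel₀ hc0, one_smul]⟩)
  have hsum' : ∀ B B', B ∈ 𝔊 → B' ∈ 𝔊 → Θ * B = B → B * Θ = -B → Θ * B' = B' → B' * Θ = -B' →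
      ∀ v₁ v₂, (B + B') v₁ ≠ 0 → (B + B') v₂ ∈ ℂ ∙ ((B + B') v₁) := by
    intro B B' hB hB' h1 h2 h3 h4 v₁ v₂ hv₁
    obtain ⟨h5, h6⟩ := hadd B B' h1 h2 h3 h4
    exact hline (B + B') (Submodule.add_mem _ hB hB') h5 h6 v₁ hv₁ v₂
  have hker12 : ∀ w, B₁ w = 0 → B₂ w = 0 := fun w hw =>
    UnitaryTwoOdd.apply_eq_zero_of_rank_le_one (x := x₂) (x' := x₁) (hline B₂ hB₂ hΘB₂ hB₂Θ w₂ hx₂0)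
      (hline B₁ hB₁ hΘB₁ hB₁Θ w₁ hw₁) hx₁2 (hsum' B₂ B₁ hB₂ hB₁ hΘB₂ hB₂Θ hΘB₁ hB₁Θ) hw₁ hw
  have hkill : ∀ B ∈ 𝔊, Θ * B = B → B * Θ = -B → ∀ w, B₁ w = 0 → B w = 0 := by
    intro B hB hΘB hBΘ w hw
    by_cases hB0 : B w = 0
    · exact hB0
    set x := B w with hxdef
    by_cases hx : x ∈ ℂ ∙ x₁
    · have hxx₂ : x₂ ∉ ℂ ∙ x := fun h => by
        obtain ⟨c, hc⟩ := Submodule.mem_span_singleton.1 hx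
        obtain ⟨c', hc'⟩ := Submodule.mem_span_singleton.1 h
        exact hw₂ (Submodule.mem_span_singleton.2 ⟨c' * c, by rw [← smul_smul, hc, hc']⟩)
      exact UnitaryTwoOdd.apply_eq_zero_of_rank_le_one (hline B hB hΘB hBΘ w hB0) (hline B₂ hB₂ hΘB₂ hB₂Θ w₂ hx₂0)
        hxx₂ (hsum' B B₂ hB hB₂ hΘB hBΘ hΘB₂ hB₂Θ) hx₂0 (hker12 w hw)
    · have hxx₁ : x₁ ∉ ℂ ∙ x := fun h => by
        obtain ⟨c, hc⟩ := Submodule.mem_span_singleton.1 h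
        have hc0 : c ≠ 0 := fun h0 => hw₁ (by rw [← hc, h0, zero_smul])
        exact hx (Submodule.mem_span_singleton.2 ⟨c⁻¹, by rw [← hc, smul_smul, inv_mul_cancel₀ hc0, one_smul]⟩)
      exact UnitaryTwoOdd.apply_eq_zero_of_rank_le_one (hline B hB hΘB hBΘ w hB0) (hline B₁ hB₁ hΘB₁ hB₁Θ w₁ hw₁)
        hxx₁ (hsum' B B₁ hB hB₁ hΘB hBΘ hΘB₁ hB₁Θ) hw₁ hw
  set H : Submodule ℂ W := LinearMap.ker B₁ with hHdef
  have hPQsup : P ⊔ Q = ⊤ := by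
    rw [eq_top_iff]
    intro v _
    have hv : (2 : ℂ)⁻¹ • (v + Θ v) + (2 : ℂ)⁻¹ • (v - Θ v) = v := by module
    rw [← hv]
    refine Submodule.add_mem_sup ((hP _).2 ?_) ((hQ _).2 ?_)
    · rw [map_smul, map_add, hΘΘv, add_comm]
    · rw [map_smul, map_sub, hΘΘv, ← smul_neg, neg_sub]
  have hPQinf : P ⊓ Q = ⊥ := by
    rw [eq_bot_iff]
    intro x hx
    rw [Submodule.mem_bot]
    have h1 := (hP x).1 hx.1
    rw [(hQ x).1 hx.2, neg_eq_iff_add_eq_zero, ← two_smul ℂ x, smul_eq_zero] at h1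
    exact h1.resolve_left (two_ne_zero' ℂ)
  have hdimW : Module.finrank ℂ W = Module.finrank ℂ P + Module.finrank ℂ Q := by
    have h := Submodule.finrank_sup_add_finrank_inf_eq P Q
    rw [hPQsup, hPQinf, finrank_top, finrank_bot, add_zero] at h
    exact h
  have hdimH : Module.finrank ℂ W ≤ Module.finrank ℂ H + 1 := by
    have h := LinearMap.finrank_range_add_finrank_ker B₁
    have h' := hrank B₁ hB₁ hΘB₁ hB₁Θ
    rw [hHdef]; omega
  have hHQ : ∃ q ∈ H ⊓ Q, q ≠ 0 := by
    by_contra hne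
    push Not at hne
    have hbot : H ⊓ Q = ⊥ := by
      rw [eq_bot_iff]; intro x hx; rw [Submodule.mem_bot]; exact hne x hx
    have h := Submodule.finrank_sup_add_finrank_inf_eq H Q
    rw [hbot, finrank_bot, add_zero] at h
    have hle := Submodule.finrank_le (H ⊔ Q)
    omega
  obtain ⟨q, hq, hq0⟩ := hHQ
  obtain ⟨hqH, hqQ⟩ := Submodule.mem_inf.1 hq
  exact hq0 (UnitaryThetaCore.eq_zero_of_forall_raise_apply_eq_zero hbr hirr hΘ hΘΘ hP0 ((hQ q).1 hqQ)
    fun B hB hΘB hBΘ => hkill B hB hΘB hBΘ q (LinearMap.mem_ker.1 hqH))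

end RankTwo

/-! ### §3 The Cayley–Hamilton projector pair of an arbitrary raising operator -/

section ProjectorPair

variable {W : Type*} [AddCommGroup W] [Module ℂ W]

/-- An operator which is `+1, 0, −1, 0` on four pieces spanning `W` and pairwise `s`-orthogonal is `s`-self-adjoint.
[cite: HoffmanKunze1971LinearAlgebra, §6.7 and §8.5] -/
theorem UnitaryThreeCoprime.selfAdjoint_of_pieces {s : W → W → ℂ} (hadd : ∀ x y z, s (x + y) z = s x z + s y z)
    (hsymm : ∀ x y, s y x = starRingEnd ℂ (s x y)) {D : Module.End ℂ W} {A₁ A₀ C₁ C₀ : Submodule ℂ W}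
    (hdec : ∀ w, ∃ a ∈ A₁, ∃ b ∈ A₀, ∃ c ∈ C₁, ∃ d ∈ C₀, w = a + b + c + d)
    (hDa : ∀ a ∈ A₁, D a = a) (hDb : ∀ b ∈ A₀, D b = 0) (hDc : ∀ c ∈ C₁, D c = -c) (hDd : ∀ d ∈ C₀, D d = 0)
    (h10 : ∀ x ∈ A₁, ∀ y ∈ A₀, s x y = 0) (h11 : ∀ x ∈ A₁, ∀ y ∈ C₁, s x y = 0) (h1d : ∀ x ∈ A₁, ∀ y ∈ C₀, s x y = 0)
    (h01 : ∀ x ∈ A₀, ∀ y ∈ C₁, s x y = 0) (hcd : ∀ x ∈ C₁, ∀ y ∈ C₀, s x y = 0) :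
    ∀ x y, s (D x) y = s x (D y) := by
  obtain ⟨haddr, h0r, h0l, hnegr, hnegl, hsubr, hsubl⟩ := UnitaryTwoOdd.herm_right hadd hsymm
  have hsy : ∀ x y, s x y = 0 → s y x = 0 := fun x y h => by rw [hsymm, h, map_zero]
  intro x y
  obtain ⟨a, ha, b, hb, c, hc, d, hd, rfl⟩ := hdec x
  obtain ⟨a', ha', b', hb', c', hc', d', hd', rfl⟩ := hdec y
  have hDx : D (a + b + c + d) = a - c := by
    rw [map_add, map_add, map_add, hDa a ha, hDb b hb, hDc c hc, hDd d hd]; abel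
  have hDy : D (a' + b' + c' + d') = a' - c' := by
    rw [map_add, map_add, map_add, hDa a' ha', hDb b' hb', hDc c' hc', hDd d' hd']; abel
  rw [hDx, hDy]
  simp only [hadd, haddr, hsubl, hsubr, h10 a ha b' hb', h11 a ha c' hc', h1d a ha d' hd', hsy _ _ (h11 a' ha' c hc),
    hsy _ _ (h01 b' hb' c hc), hcd c hc d' hd', hsy _ _ (h10 a' ha' b hb), h01 b hb c' hc', hsy _ _ (hcd c' hc' d hd),
    hsy _ _ (h1d a' ha' d hd), add_zero, sub_zero]

/-- **The Cayley–Hamilton projector pair of a raising operator.** Let `𝔊 ∋ Θ` be bracket-closed with Hermitian data,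
`B ∈ 𝔊` raising (of any rank) with `s`-adjoint `C ∈ 𝔊`. Positivity gives `BCp = 0 ⟹ Cp = 0` (`p ∈ P`) and
`CBw = 0 ⟹ Bw = 0`, so `BC` is invertible on `P₁ = B(W)`; with `χ` its characteristic polynomial there and `δ = χ(0)`,
the element `D = δ⁻¹(χ(CB) − χ(BC)) ∈ 𝔊` (`UnitaryThetaCore.aeval_sub_aeval_mem`) is `+1` on `P₁`, `0` on
`P₀ = P ∩ ker C`, `−1` on `Q₁ = C(P)`, `0` on `Q₀ = Q ∩ ker B`; `P = P₁ ⊕ P₀`, `Q = Q₁ ⊕ Q₀` (the components of `p`,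
`q` being `Dp`, `p − Dp`, `−Dq`, `q + Dq`), `D` commutes with `Θ` and is `s`-self-adjoint. (The tree's
`UnitaryTwoOdd.exists_idempotent_of_fullRank_pair` is the case `P₁ = P`, where `E = D − Θ… = −Θ + D`.)
[cite: Ribet1983, Thm. 3] [cite: Gordon1997, §6 (proof of Thm. 6.3.3, pp. 18–19)] [cite: GoodmanWallachGTM255, §4.1.1]
[cite: Deligne1982HodgeCycles, I §3 (proof of Prop. 3.6)] -/
theorem UnitaryThreeCoprime.exists_projector_pair [FiniteDimensional ℂ W] {𝔊 : Submodule ℂ (Module.End ℂ W)}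
    (hbr : ∀ Y ∈ 𝔊, ∀ Z ∈ 𝔊, Y * Z - Z * Y ∈ 𝔊) {Θ : Module.End ℂ W} (hΘΘ : Θ * Θ = 1)
    {P Q : Submodule ℂ W} (hP : ∀ x, x ∈ P ↔ Θ x = x) (hQ : ∀ x, x ∈ Q ↔ Θ x = -x)
    {s : W → W → ℂ} (hadd : ∀ x y z, s (x + y) z = s x z + s y z) (hsymm : ∀ x y, s y x = starRingEnd ℂ (s x y))
    (hPQ : ∀ p ∈ P, ∀ q ∈ Q, s p q = 0) (hdefP : ∀ p ∈ P, s p p = 0 → p = 0) (hdefQ : ∀ q ∈ Q, s q q = 0 → q = 0)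
    {B C : Module.End ℂ W} (hB : B ∈ 𝔊) (hC : C ∈ 𝔊) (hΘB : Θ * B = B) (hBΘ : B * Θ = -B)
    (hBC : ∀ x y, s (B x) y = s x (C y)) :
    ∃ D ∈ 𝔊, D * Θ = Θ * D ∧ (∀ w, D (B w) = B w) ∧ (∀ p ∈ P, C p = 0 → D p = 0) ∧
      (∀ p ∈ P, D (C p) = -(C p)) ∧ (∀ q ∈ Q, B q = 0 → D q = 0) ∧
      (∀ p ∈ P, D p ∈ LinearMap.range B ∧ C (p - D p) = 0) ∧ (∀ q ∈ Q, D q ∈ P.map C ∧ B (q + D q) = 0) ∧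
      (∀ p ∈ P, B (C p) = 0 → C p = 0) ∧ (∀ w, C (B w) = 0 → B w = 0) ∧
      (∀ w, ∃ a ∈ LinearMap.range B, ∃ b ∈ P ⊓ LinearMap.ker C, ∃ c ∈ P.map C, ∃ d ∈ Q ⊓ LinearMap.ker B,
        w = a + b + c + d) ∧
      (∀ x y, s (D x) y = s x (D y)) := by
  classical
  obtain ⟨haddr, h0r, h0l, hnegr, hnegl, hsubr, hsubl⟩ := UnitaryTwoOdd.herm_right hadd hsymm
  have hΘΘv : ∀ v, Θ (Θ v) = v := fun v => by rw [← Module.End.mul_apply, hΘΘ, Module.End.one_apply]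
  obtain ⟨hΘC, hCΘ⟩ := UnitaryTwoOdd.lower_of_adjoint hadd hsymm hΘΘ hP hQ hPQ hdefP hdefQ hΘB hBΘ hBC
  have hBB : B * B = 0 := UnitaryThetaCore.mul_self_eq_zero_of_raise hΘB hBΘ
  have hCC : C * C = 0 := UnitaryThetaCore.mul_self_eq_zero_of_lower hΘC hCΘ
  have hBP : ∀ p ∈ P, B p = 0 := fun p hp => by
    have h : B p = -(B p) := by
      conv_lhs => rw [← (hP p).1 hp]
      rw [← Module.End.mul_apply, hBΘ, LinearMap.neg_apply]
    have h2 : (2 : ℂ) • B p = 0 := by rw [two_smul]; nth_rewrite 2 [h]; rw [add_neg_cancel]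
    exact (smul_eq_zero.1 h2).resolve_left two_ne_zero
  have hCQ : ∀ q ∈ Q, C q = 0 := fun q hq => by
    have h : C q = -(C q) := by
      conv_lhs => rw [← neg_neg q, ← (hQ q).1 hq, map_neg, ← Module.End.mul_apply, hCΘ]
    have h2 : (2 : ℂ) • C q = 0 := by rw [two_smul]; nth_rewrite 2 [h]; rw [add_neg_cancel]
    exact (smul_eq_zero.1 h2).resolve_left two_ne_zero
  have hBmem : ∀ w, B w ∈ P := fun w => (hP _).2 (by rw [← Module.End.mul_apply, hΘB])
  have hCmem : ∀ w, C w ∈ Q := fun w => (hQ _).2 (by rw [← Module.End.mul_apply, hΘC, LinearMap.neg_apply])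
  have hPhat : ∀ w, (2 : ℂ)⁻¹ • (w + Θ w) ∈ P := fun w => (hP _).2 (by rw [map_smul, map_add, hΘΘv, add_comm])
  have hQhat : ∀ w, (2 : ℂ)⁻¹ • (w - Θ w) ∈ Q := fun w =>
    (hQ _).2 (by rw [map_smul, map_sub, hΘΘv, ← smul_neg, neg_sub])
  have hsplit : ∀ w, (2 : ℂ)⁻¹ • (w + Θ w) + (2 : ℂ)⁻¹ • (w - Θ w) = w := fun w => by module
  -- positivity
  have hpos1 : ∀ p ∈ P, B (C p) = 0 → C p = 0 := fun p _ h => hdefQ _ (hCmem p) (by rw [← hBC, h, h0l])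
  have hpos2 : ∀ w, C (B w) = 0 → B w = 0 := fun w h => hdefP _ (hBmem w) (by rw [hBC, h, h0r])
  -- `f = BC|_{P₁}`, `P₁ = B(W)`
  set P₁ : Submodule ℂ W := LinearMap.range B with hP₁def
  have hP₁P : P₁ ≤ P := by rintro _ ⟨w, rfl⟩; exact hBmem w
  have hf : ∀ x ∈ P₁, (B * C) x ∈ P₁ := fun x _ => LinearMap.mem_range_self B _
  set f : Module.End ℂ P₁ := (B * C).restrict hf with hfdef
  have hfinj : Function.Injective f := by
    intro x y hxy
    apply Subtype.ext
    have h : ((f x : P₁) : W) = (f y : W) := by rw [hxy]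
    rw [hfdef, LinearMap.coe_restrict_apply, LinearMap.coe_restrict_apply, Module.End.mul_apply,
      Module.End.mul_apply, ← sub_eq_zero, ← map_sub, ← map_sub] at h
    have hxy' : (x : W) - y ∈ P₁ := Submodule.sub_mem _ x.2 y.2
    obtain ⟨w, hw⟩ := hxy'
    have hC0 : C ((x : W) - y) = 0 := hpos1 _ (hP₁P (Submodule.sub_mem _ x.2 y.2)) h
    rw [← hw] at hC0
    have := hpos2 w hC0
    rw [hw] at this
    exact sub_eq_zero.1 this
  have hfsurj : Function.Surjective f := LinearMap.injective_iff_surjective.1 hfinj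
  set χ : ℂ[X] := f.charpoly with hχdef
  set δ : ℂ := χ.coeff 0 with hδdef
  have hδ : δ ≠ 0 := by
    intro h0
    have hdet : LinearMap.det f = 0 := by
      rw [LinearMap.det_eq_sign_charpoly_coeff, ← hχdef, ← hδdef, h0, mul_zero]
    have hu := (LinearMap.isUnit_iff_isUnit_det f).1
      ((LinearMap.isUnit_iff_ker_eq_bot f).2 (LinearMap.ker_eq_bot.2 hfinj))
    rw [hdet] at hu
    exact not_isUnit_zero hu
  have hCH : ∀ x ∈ P₁, aeval (B * C) χ x = 0 := fun x hx => by
    have h := UnitaryThetaCore.aeval_restrict_coe hf χ ⟨x, hx⟩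
    rw [hχdef, LinearMap.aeval_self_charpoly, LinearMap.zero_apply, Submodule.coe_zero] at h
    rw [hχdef, ← h]
  -- the element `D`
  set D : Module.End ℂ W := δ⁻¹ • (aeval (C * B) χ - aeval (B * C) χ) with hDdef
  have hDmem : D ∈ 𝔊 := by
    rw [hDdef, ← neg_sub]
    exact Submodule.smul_mem _ _ (Submodule.neg_mem _ (UnitaryThetaCore.aeval_sub_aeval_mem hbr hB hC hBB χ))
  have hDapply : ∀ w, D w = δ⁻¹ • (aeval (C * B) χ w - aeval (B * C) χ w) := fun w => by
    rw [hDdef, LinearMap.smul_apply, LinearMap.sub_apply]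
  -- `D` on `P₁`
  have hD1 : ∀ w, D (B w) = B w := fun w => by
    have h1 : (C * B) (B w) = 0 := by rw [Module.End.mul_apply, ← Module.End.mul_apply (f := B), hBB, LinearMap.zero_apply, map_zero]
    rw [hDapply, UnitaryThetaCore.aeval_apply_of_apply_eq_zero _ _ h1, hCH _ (LinearMap.mem_range_self B w), ← hδdef,
      sub_zero, smul_smul, inv_mul_cancel₀ hδ, one_smul]
  -- `D` on `P₀`
  have hD2 : ∀ p ∈ P, C p = 0 → D p = 0 := fun p hp hCp => by
    have h1 : (C * B) p = 0 := by rw [Module.End.mul_apply, hBP p hp, map_zero]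
    have h2 : (B * C) p = 0 := by rw [Module.End.mul_apply, hCp, map_zero]
    rw [hDapply, UnitaryThetaCore.aeval_apply_of_apply_eq_zero _ _ h1,
      UnitaryThetaCore.aeval_apply_of_apply_eq_zero _ _ h2, sub_self, smul_zero]
  -- the `P`-decomposition
  have hPdec : ∀ p ∈ P, ∃ x ∈ P₁, C (p - x) = 0 := fun p hp => by
    obtain ⟨x, hx⟩ := hfsurj ⟨(B * C) p, LinearMap.mem_range_self B _⟩
    have hx' : B (C (x : W)) = B (C p) := by
      have h := congrArg Subtype.val hx
      rw [hfdef, LinearMap.coe_restrict_apply, Module.End.mul_apply] at h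
      exact h
    refine ⟨x, x.2, hpos1 _ (Submodule.sub_mem _ hp (hP₁P x.2)) ?_⟩
    rw [map_sub, map_sub, hx', sub_self]
  have hD5 : ∀ p ∈ P, D p ∈ LinearMap.range B ∧ C (p - D p) = 0 := fun p hp => by
    obtain ⟨x, hx, hCpx⟩ := hPdec p hp
    obtain ⟨w, rfl⟩ := hx
    have hDp : D p = B w := by
      have h : p = B w + (p - B w) := by abel
      rw [h, map_add, hD1, hD2 _ (Submodule.sub_mem _ hp (hBmem w)) hCpx, add_zero]
    rw [hDp]
    exact ⟨LinearMap.mem_range_self B w, hCpx⟩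
  -- `D` on `Q₁ = C(P)`
  have hD3 : ∀ p ∈ P, D (C p) = -(C p) := fun p hp => by
    obtain ⟨x, hx, hCpx⟩ := hPdec p hp
    have hCp : C p = C x := by rw [map_sub, sub_eq_zero] at hCpx; exact hCpx
    have h1 : aeval (C * B) χ (C x) = 0 := by
      rw [← Module.End.mul_apply, UnitaryTwoOdd.aeval_mul_eq_mul_aeval, Module.End.mul_apply, hCH x hx, map_zero]
    have h2 : (B * C) (C x) = 0 := by
      rw [Module.End.mul_apply, ← Module.End.mul_apply (f := C), hCC, LinearMap.zero_apply, map_zero]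
    rw [hCp, hDapply, h1, UnitaryThetaCore.aeval_apply_of_apply_eq_zero _ _ h2, ← hδdef, zero_sub, smul_neg,
      smul_smul, inv_mul_cancel₀ hδ, one_smul]
  -- `D` on `Q₀`
  have hD4 : ∀ q ∈ Q, B q = 0 → D q = 0 := fun q hq hBq => by
    have h1 : (C * B) q = 0 := by rw [Module.End.mul_apply, hBq, map_zero]
    have h2 : (B * C) q = 0 := by rw [Module.End.mul_apply, hCQ q hq, map_zero]
    rw [hDapply, UnitaryThetaCore.aeval_apply_of_apply_eq_zero _ _ h1,
      UnitaryThetaCore.aeval_apply_of_apply_eq_zero _ _ h2, sub_self, smul_zero]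
  -- the `Q`-decomposition
  have hD6 : ∀ q ∈ Q, D q ∈ P.map C ∧ B (q + D q) = 0 := fun q hq => by
    obtain ⟨x, hx⟩ := hfsurj ⟨B q, LinearMap.mem_range_self B q⟩
    have hx' : B (C (x : W)) = B q := by
      have h := congrArg Subtype.val hx
      rw [hfdef, LinearMap.coe_restrict_apply, Module.End.mul_apply] at h
      exact h
    have hxP : (x : W) ∈ P := hP₁P x.2
    have hB0 : B (q - C x) = 0 := by rw [map_sub, hx', sub_self]
    have hDq : D q = -(C x) := by
      have h : q = (q - C x) + C x := by abel
      rw [h, map_add, hD4 _ (Submodule.sub_mem _ hq (hCmem _)) hB0, hD3 _ hxP, zero_add]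
    rw [hDq]
    refine ⟨Submodule.neg_mem _ ⟨x, hxP, rfl⟩, ?_⟩
    rw [← sub_eq_add_neg, hB0]
  -- `D` commutes with `Θ`
  have hDΘ : D * Θ = Θ * D := by
    have hΘCB : Θ * (C * B) = C * B * Θ := by rw [← mul_assoc, hΘC, mul_assoc, hBΘ, neg_mul, mul_neg]
    have hΘBC : Θ * (B * C) = B * C * Θ := by rw [← mul_assoc, hΘB, mul_assoc, hCΘ]
    rw [hDdef, smul_mul_assoc, mul_smul_comm, sub_mul, mul_sub, UnitaryThetaCore.commute_aeval hΘCB,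
      UnitaryThetaCore.commute_aeval hΘBC]
  -- the four-piece decomposition
  have hdec : ∀ w, ∃ a ∈ LinearMap.range B, ∃ b ∈ P ⊓ LinearMap.ker C, ∃ c ∈ P.map C, ∃ d ∈ Q ⊓ LinearMap.ker B,
      w = a + b + c + d := fun w => by
    set p := (2 : ℂ)⁻¹ • (w + Θ w)
    set q := (2 : ℂ)⁻¹ • (w - Θ w)
    obtain ⟨hDp, hCp⟩ := hD5 p (hPhat w)
    obtain ⟨hDq, hBq⟩ := hD6 q (hQhat w)
    refine ⟨D p, hDp, p - D p, Submodule.mem_inf.2 ⟨Submodule.sub_mem _ (hPhat w) (hP₁P hDp), LinearMap.mem_ker.2 hCp⟩,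
      -(D q), Submodule.neg_mem _ hDq, q + D q,
      Submodule.mem_inf.2 ⟨Submodule.add_mem _ (hQhat w) ?_, LinearMap.mem_ker.2 hBq⟩, ?_⟩
    · obtain ⟨x, hx, hxq⟩ := hDq
      rw [← hxq]; exact hCmem x
    · rw [← hsplit w]; abel
  -- self-adjointness
  have hsa : ∀ x y, s (D x) y = s x (D y) := by
    refine UnitaryThreeCoprime.selfAdjoint_of_pieces hadd hsymm hdec (fun a ha => ?_) (fun b hb => ?_) (fun c hc => ?_)
      (fun d hd => ?_) (fun x hx y hy => ?_) (fun x hx y hy => ?_) (fun x hx y hy => ?_) (fun x hx y hy => ?_)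
      (fun x hx y hy => ?_)
    · obtain ⟨w, rfl⟩ := ha; exact hD1 w
    · exact hD2 b (Submodule.mem_inf.1 hb).1 (LinearMap.mem_ker.1 (Submodule.mem_inf.1 hb).2)
    · obtain ⟨p, hp, rfl⟩ := hc; exact hD3 p hp
    · exact hD4 d (Submodule.mem_inf.1 hd).1 (LinearMap.mem_ker.1 (Submodule.mem_inf.1 hd).2)
    · obtain ⟨w, rfl⟩ := hx
      rw [hBC, LinearMap.mem_ker.1 (Submodule.mem_inf.1 hy).2, h0r]
    · obtain ⟨p, hp, rfl⟩ := hy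
      exact hPQ _ (hP₁P hx) _ (hCmem p)
    · exact hPQ _ (hP₁P hx) _ (Submodule.mem_inf.1 hy).1
    · obtain ⟨p, hp, rfl⟩ := hy
      exact hPQ _ (Submodule.mem_inf.1 hx).1 _ (hCmem p)
    · obtain ⟨p, hp, rfl⟩ := hx
      rw [hsymm, ← hBC, LinearMap.mem_ker.1 (Submodule.mem_inf.1 hy).2, h0l, map_zero]
  exact ⟨D, hDmem, hDΘ, hD1, hD2, hD3, hD4, hD5, hD6, hpos1, hpos2, hdec, hsa⟩

end ProjectorPair

/-! ### §4 The Levi instance of a pair of commuting involutions -/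

section LeviInstance

variable {W : Type*} [AddCommGroup W] [Module ℂ W]

/-- **The Levi instance.** Let `𝔊` be bracket-closed and irreducible with Hermitian data (relative to `Θ`), and let
`Θ₁, Θ₂ ∈ 𝔊` be commuting involutions, `Θ₁` `s`-self-adjoint; put `U = {Θ₁ = −1}` and let `P_U, Q_U ⊆ U` be the
`(±1)`-eigenspaces of `Θ₂` on `U`, assumed `s`-orthogonal with `s` definite on each. The restrictions to `U` of the
`Θ₁`-commuting elements of `𝔊` form a bracket-closed subspace `𝔩 ⊆ End(U)`, acting irreducibly
(`UnitaryTwoOdd.levi_irreducible`), containing the involution `Θ₂|_U`, and closed under `s|_U`-adjoints (the adjoint of a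
`Θ₁`-commuting element commutes with `Θ₁`, by non-degeneracy); hence any core theorem `hcore` for the multiplicities
`(dim P_U, dim Q_U)` shows `𝔩 = End(U)`: every endomorphism of `U` is the restriction of a `Θ₁`-commuting element of `𝔊`.
[cite: GoodmanWallachGTM255, §4.1.1] [cite: Gordon1997, §6 (proof of Thm. 6.3.3, p. 19)]
[cite: Deligne1982HodgeCycles, I §3 (proof of Prop. 3.4)] -/
theorem UnitaryThreeCoprime.levi_instance [FiniteDimensional ℂ W] {𝔊 : Submodule ℂ (Module.End ℂ W)}
    (hbr : ∀ Y ∈ 𝔊, ∀ Z ∈ 𝔊, Y * Z - Z * Y ∈ 𝔊)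
    (hirr : ∀ U : Submodule ℂ W, (∀ A ∈ 𝔊, ∀ u ∈ U, A u ∈ U) → U = ⊥ ∨ U = ⊤)
    {Θ : Module.End ℂ W} (hΘΘ : Θ * Θ = 1)
    {P Q : Submodule ℂ W} (hP : ∀ x, x ∈ P ↔ Θ x = x) (hQ : ∀ x, x ∈ Q ↔ Θ x = -x)
    {s : W → W → ℂ} (hadd : ∀ x y z, s (x + y) z = s x z + s y z) (hsymm : ∀ x y, s y x = starRingEnd ℂ (s x y))
    (hPQ : ∀ p ∈ P, ∀ q ∈ Q, s p q = 0) (hdefP : ∀ p ∈ P, s p p = 0 → p = 0) (hdefQ : ∀ q ∈ Q, s q q = 0 → q = 0)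
    (hadj : ∀ X ∈ 𝔊, ∃ Y ∈ 𝔊, ∀ x y, s (X x) y = s x (Y y))
    {Θ₁ Θ₂ : Module.End ℂ W} (hΘ₁ : Θ₁ ∈ 𝔊) (hΘ₁Θ₁ : Θ₁ * Θ₁ = 1) (hΘ₁s : ∀ x y, s (Θ₁ x) y = s x (Θ₁ y))
    (hΘ₂ : Θ₂ ∈ 𝔊) (hΘ₂Θ₂ : Θ₂ * Θ₂ = 1) (h12 : Θ₁ * Θ₂ = Θ₂ * Θ₁)
    {U : Submodule ℂ W} (hU : ∀ x, x ∈ U ↔ Θ₁ x = -x)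
    {PU QU : Submodule ℂ W} (hPUle : PU ≤ U) (hQUle : QU ≤ U)
    (hPUmem : ∀ x ∈ U, Θ₂ x = x → x ∈ PU) (hPUΘ₂ : ∀ x ∈ PU, Θ₂ x = x)
    (hQUmem : ∀ x ∈ U, Θ₂ x = -x → x ∈ QU) (hQUΘ₂ : ∀ x ∈ QU, Θ₂ x = -x)
    (hPUQU : ∀ x ∈ PU, ∀ y ∈ QU, s x y = 0) (hdefPU : ∀ x ∈ PU, s x x = 0 → x = 0)
    (hdefQU : ∀ y ∈ QU, s y y = 0 → y = 0)
    (hcore : ∀ (𝔩 : Submodule ℂ (Module.End ℂ U)) (ι : Module.End ℂ U) (P' Q' : Submodule ℂ U),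
      (∀ A ∈ 𝔩, ∀ A' ∈ 𝔩, A * A' - A' * A ∈ 𝔩) →
      (∀ V : Submodule ℂ U, (∀ A ∈ 𝔩, ∀ u ∈ V, A u ∈ V) → V = ⊥ ∨ V = ⊤) →
      ι ∈ 𝔩 → ι * ι = 1 → (∀ x, x ∈ P' ↔ ι x = x) → (∀ x, x ∈ Q' ↔ ι x = -x) →
      Module.finrank ℂ P' = Module.finrank ℂ PU → Module.finrank ℂ Q' = Module.finrank ℂ QU →
      (∀ p ∈ P', ∀ q ∈ Q', s (p : W) q = 0) → (∀ p ∈ P', s (p : W) p = 0 → p = 0) →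
      (∀ q ∈ Q', s (q : W) q = 0 → q = 0) →
      (∀ A ∈ 𝔩, ∃ A' ∈ 𝔩, ∀ x y : U, s ((A x : U) : W) y = s x ((A' y : U) : W)) → 𝔩 = ⊤) :
    ∀ T : Module.End ℂ U, ∃ Z ∈ 𝔊, Z * Θ₁ = Θ₁ * Z ∧ ∀ x : U, ((T x : U) : W) = Z x := by
  classical
  obtain ⟨haddr, h0r, h0l, hnegr, hnegl, hsubr, hsubl⟩ := UnitaryTwoOdd.herm_right hadd hsymm
  have hΘ₁v : ∀ v, Θ₁ (Θ₁ v) = v := fun v => by rw [← Module.End.mul_apply, hΘ₁Θ₁, Module.End.one_apply]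
  have hΘ₂v : ∀ v, Θ₂ (Θ₂ v) = v := fun v => by rw [← Module.End.mul_apply, hΘ₂Θ₂, Module.End.one_apply]
  -- the `+1`-eigenspace of `Θ₁`
  set Up : Submodule ℂ W := LinearMap.ker (Θ₁ - 1) with hUpdef
  have hUp : ∀ x, x ∈ Up ↔ Θ₁ x = x := fun x => by
    rw [hUpdef, LinearMap.mem_ker, LinearMap.sub_apply, Module.End.one_apply, sub_eq_zero]
  have hcommU : ∀ Z : Module.End ℂ W, Z * Θ₁ = Θ₁ * Z → ∀ x ∈ U, Z x ∈ U := fun Z hZ x hx =>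
    (hU _).2 (by rw [← Module.End.mul_apply, ← hZ, Module.End.mul_apply, (hU x).1 hx, map_neg])
  -- the Levi restriction algebra
  set 𝔩 : Submodule ℂ (Module.End ℂ U) :=
    { carrier := {A | ∃ Z ∈ 𝔊, Z * Θ₁ = Θ₁ * Z ∧ ∀ x : U, ((A x : U) : W) = Z x}
      zero_mem' := ⟨0, Submodule.zero_mem _, by rw [zero_mul, mul_zero], fun x => by simp⟩
      add_mem' := by
        rintro A A' ⟨Z, hZ, hZΘ, hAZ⟩ ⟨Z', hZ', hZ'Θ, hAZ'⟩
        exact ⟨Z + Z', Submodule.add_mem _ hZ hZ', by rw [add_mul, mul_add, hZΘ, hZ'Θ], fun x => by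
          rw [LinearMap.add_apply, Submodule.coe_add, hAZ, hAZ', LinearMap.add_apply]⟩
      smul_mem' := by
        rintro c A ⟨Z, hZ, hZΘ, hAZ⟩
        exact ⟨c • Z, Submodule.smul_mem _ c hZ, by rw [smul_mul_assoc, mul_smul_comm, hZΘ], fun x => by
          rw [LinearMap.smul_apply, Submodule.coe_smul, hAZ, LinearMap.smul_apply]⟩ } with h𝔩def
  have hmem𝔩 : ∀ A, A ∈ 𝔩 ↔ ∃ Z ∈ 𝔊, Z * Θ₁ = Θ₁ * Z ∧ ∀ x : U, ((A x : U) : W) = Z x := fun A => Iff.rfl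
  have hres : ∀ Z ∈ 𝔊, Z * Θ₁ = Θ₁ * Z → ∃ A ∈ 𝔩, ∀ x : U, ((A x : U) : W) = Z x := fun Z hZ hZΘ =>
    ⟨Z.restrict fun x hx => hcommU Z hZΘ x hx, ⟨Z, hZ, hZΘ, fun x => rfl⟩, fun x => rfl⟩
  have hbr𝔩 : ∀ A ∈ 𝔩, ∀ A' ∈ 𝔩, A * A' - A' * A ∈ 𝔩 := by
    intro A hA A' hA'
    obtain ⟨Z, hZ, hZΘ, hAZ⟩ := (hmem𝔩 A).1 hA
    obtain ⟨Z', hZ', hZ'Θ, hAZ'⟩ := (hmem𝔩 A').1 hA'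
    refine (hmem𝔩 _).2 ⟨Z * Z' - Z' * Z, hbr Z hZ Z' hZ', ?_, fun x => ?_⟩
    · rw [sub_mul, mul_sub, mul_assoc, hZ'Θ, ← mul_assoc, hZΘ, mul_assoc, mul_assoc, hZΘ, ← mul_assoc Z', hZ'Θ,
        mul_assoc]
    · rw [LinearMap.sub_apply, Submodule.coe_sub, Module.End.mul_apply, Module.End.mul_apply, hAZ, hAZ', hAZ', hAZ,
        LinearMap.sub_apply, Module.End.mul_apply, Module.End.mul_apply]
  have hirr𝔩 := UnitaryTwoOdd.levi_irreducible hbr hirr hΘ₁ hΘ₁Θ₁ hUp hU 𝔩 hres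
  -- the involution `ι = Θ₂|_U`
  set ι : Module.End ℂ U := Θ₂.restrict fun x hx => hcommU Θ₂ h12.symm x hx with hιdef
  have hιapply : ∀ x : U, ((ι x : U) : W) = Θ₂ x := fun x => rfl
  have hι : ι ∈ 𝔩 := (hmem𝔩 ι).2 ⟨Θ₂, hΘ₂, h12.symm, hιapply⟩
  have hιι : ι * ι = 1 := LinearMap.ext fun x => Subtype.ext (by
    rw [Module.End.mul_apply, Module.End.one_apply, hιapply, hιapply, hΘ₂v])
  set P' : Submodule ℂ U := Submodule.comap U.subtype PU with hP'def
  set Q' : Submodule ℂ U := Submodule.comap U.subtype QU with hQ'def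
  have hP' : ∀ x, x ∈ P' ↔ ι x = x := fun x => by
    rw [hP'def, Submodule.mem_comap, Submodule.subtype_apply]
    constructor
    · intro h; exact Subtype.ext (by rw [hιapply, hPUΘ₂ _ h])
    · intro h; exact hPUmem _ x.2 (by rw [← hιapply, h])
  have hQ' : ∀ x, x ∈ Q' ↔ ι x = -x := fun x => by
    rw [hQ'def, Submodule.mem_comap, Submodule.subtype_apply]
    constructor
    · intro h; exact Subtype.ext (by rw [hιapply, hQUΘ₂ _ h, Submodule.coe_neg])
    · intro h; exact hQUmem _ x.2 (by rw [← hιapply, h, Submodule.coe_neg])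
  have hfinP' : Module.finrank ℂ P' = Module.finrank ℂ PU := by
    rw [hP'def, (Submodule.comapSubtypeEquivOfLe hPUle).finrank_eq]
  have hfinQ' : Module.finrank ℂ Q' = Module.finrank ℂ QU := by
    rw [hQ'def, (Submodule.comapSubtypeEquivOfLe hQUle).finrank_eq]
  have hP'Q' : ∀ p ∈ P', ∀ q ∈ Q', s (p : W) q = 0 := fun p hp q hq => hPUQU _ hp _ hq
  have hdefP' : ∀ p ∈ P', s (p : W) p = 0 → p = 0 := fun p hp h => Subtype.ext (hdefPU _ hp h)
  have hdefQ' : ∀ q ∈ Q', s (q : W) q = 0 → q = 0 := fun q hq h => Subtype.ext (hdefQU _ hq h)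
  -- adjoints
  have hadj𝔩 : ∀ A ∈ 𝔩, ∃ A' ∈ 𝔩, ∀ x y : U, s ((A x : U) : W) y = s x ((A' y : U) : W) := by
    intro A hA
    obtain ⟨Z, hZ, hZΘ, hAZ⟩ := (hmem𝔩 A).1 hA
    obtain ⟨Z', hZ', hZZ'⟩ := hadj Z hZ
    have hZ'Θ : Z' * Θ₁ = Θ₁ * Z' := by
      refine LinearMap.ext fun y => ?_
      rw [← sub_eq_zero, ← LinearMap.sub_apply]
      refine UnitaryTwoOdd.eq_zero_of_forall_left hadd hsymm hΘΘ hP hQ hPQ hdefP hdefQ fun x => ?_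
      rw [LinearMap.sub_apply, hsubr, Module.End.mul_apply, Module.End.mul_apply, ← hZZ', ← hΘ₁s, ← hΘ₁s, ← hZZ',
        ← Module.End.mul_apply, ← Module.End.mul_apply, hZΘ, sub_self]
    obtain ⟨A', hA', hA'Z'⟩ := hres Z' hZ' hZ'Θ
    exact ⟨A', hA', fun x y => by rw [hAZ, hA'Z', hZZ']⟩
  have h𝔩top : 𝔩 = ⊤ := hcore 𝔩 ι P' Q' hbr𝔩 hirr𝔩 hι hιι hP' hQ' hfinP' hfinQ' hP'Q' hdefP' hdefQ' hadj𝔩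
  intro T
  exact (hmem𝔩 T).1 (h𝔩top ▸ Submodule.mem_top)

end LeviInstance

/-! ### §5 The rank-three raising lemma -/

section RankThree

variable {W : Type*} [AddCommGroup W] [Module ℂ W]

/-- **THE RANK-THREE RAISING LEMMA.** Let `𝔊 ∋ Θ` be bracket-closed and irreducible with Hermitian data, `dim P = 3`,
`dim Q ≥ 4`. Then some raising operator of `𝔊` maps onto `P`. (Module docstring, §5: a raising `B` of rank `2` would be
of maximal rank; with the projector pair `D` of §3, every raising `B'` maps `Q₀ = Q ∩ ker B` into `P₁ = B(W)` (★) and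
`B'CB''q + B''CB'q ∈ P₁` for `q ∈ Q₀` (♣); the Levi instance of `Θ' = 2D − Θ` on `{Θ' = −1} = P₀ ⊕ Q₁`, of
`Θ`-multiplicities `(1,2)`, is `End` by `UnitaryTwoOdd.eq_top'`, producing raising `B₁, B₂` with `Bⱼ(Ceₖ) = δⱼₖη`;
(♣) then pins every raising operator on `Q₀` to `ℂB₁ + ℂB₂` with alternating coordinates, and `dim Q₀ ≥ 2` yields a
non-zero vector of `Q` killed by all raising operators, against `UnitaryThetaCore.eq_zero_of_forall_raise_apply_eq_zero`.)
[cite: Ribet1983, Thm. 3] [cite: Gordon1997, Thm. 6.3 (3) and pp. 18–19] [cite: Deligne1982HodgeCycles, I §3 Prop. 3.4, 3.6]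
[cite: GoodmanWallachGTM255, §4.1.1] -/
theorem UnitaryThreeCoprime.exists_raise_onto_three [FiniteDimensional ℂ W] {𝔊 : Submodule ℂ (Module.End ℂ W)}
    (hbr : ∀ Y ∈ 𝔊, ∀ Z ∈ 𝔊, Y * Z - Z * Y ∈ 𝔊)
    (hirr : ∀ U : Submodule ℂ W, (∀ A ∈ 𝔊, ∀ u ∈ U, A u ∈ U) → U = ⊥ ∨ U = ⊤)
    {Θ : Module.End ℂ W} (hΘ : Θ ∈ 𝔊) (hΘΘ : Θ * Θ = 1)
    {P Q : Submodule ℂ W} (hP : ∀ x, x ∈ P ↔ Θ x = x) (hQ : ∀ x, x ∈ Q ↔ Θ x = -x)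
    (hP3 : Module.finrank ℂ P = 3) (hQ4 : 4 ≤ Module.finrank ℂ Q)
    {s : W → W → ℂ} (hadd : ∀ x y z, s (x + y) z = s x z + s y z) (hsymm : ∀ x y, s y x = starRingEnd ℂ (s x y))
    (hPQ : ∀ p ∈ P, ∀ q ∈ Q, s p q = 0) (hdefP : ∀ p ∈ P, s p p = 0 → p = 0) (hdefQ : ∀ q ∈ Q, s q q = 0 → q = 0)
    (hadj : ∀ X ∈ 𝔊, ∃ Y ∈ 𝔊, ∀ x y, s (X x) y = s x (Y y)) :
    ∃ B ∈ 𝔊, Θ * B = B ∧ B * Θ = -B ∧ ∀ p ∈ P, ∃ w, B w = p := by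
  classical
  obtain ⟨haddr, h0r, h0l, hnegr, hnegl, hsubr, hsubl⟩ := UnitaryTwoOdd.herm_right hadd hsymm
  have hΘΘv : ∀ v, Θ (Θ v) = v := fun v => by rw [← Module.End.mul_apply, hΘΘ, Module.End.one_apply]
  have hPhat : ∀ w, (2 : ℂ)⁻¹ • (w + Θ w) ∈ P := fun w => (hP _).2 (by rw [map_smul, map_add, hΘΘv, add_comm])
  have hQhat : ∀ w, (2 : ℂ)⁻¹ • (w - Θ w) ∈ Q := fun w =>
    (hQ _).2 (by rw [map_smul, map_sub, hΘΘv, ← smul_neg, neg_sub])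
  have hsplit : ∀ w, (2 : ℂ)⁻¹ • (w + Θ w) + (2 : ℂ)⁻¹ • (w - Θ w) = w := fun w => by module
  have hP0 : ∃ p : W, p ≠ 0 ∧ Θ p = p := by
    obtain ⟨⟨p, hp⟩, hp0⟩ := Module.finrank_pos_iff_exists_ne_zero.1 (show 0 < Module.finrank ℂ P by omega)
    exact ⟨p, fun h => hp0 (Subtype.ext h), (hP p).1 hp⟩
  have hraiseval : ∀ Z : Module.End ℂ W, Θ * Z = Z → ∀ w, Z w ∈ P := fun Z hΘZ w =>
    (hP _).2 (by rw [← Module.End.mul_apply, hΘZ])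
  have hraiseP : ∀ Z : Module.End ℂ W, Z * Θ = -Z → ∀ p ∈ P, Z p = 0 := fun Z hZΘ p hp => by
    have h : Z p = -(Z p) := by
      conv_lhs => rw [← (hP p).1 hp]
      rw [← Module.End.mul_apply, hZΘ, LinearMap.neg_apply]
    have h2 : (2 : ℂ) • Z p = 0 := by rw [two_smul]; nth_rewrite 2 [h]; rw [add_neg_cancel]
    exact (smul_eq_zero.1 h2).resolve_left two_ne_zero
  have hΘs := UnitaryTwoOdd.theta_selfAdjoint hadd hsymm hΘΘ hP hQ hPQ
  by_contra hcon
  push Not at hcon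
  -- STEP 1: a raising operator `B` of rank exactly `2`, its adjoint `C` and the projector pair `D`
  obtain ⟨B, hB, hΘB, hBΘ, hrk⟩ :=
    UnitaryThreeCoprime.exists_raise_rank_ge_two hbr hirr hΘ hΘΘ hP hQ (by omega) (by omega)
  have hBmem : ∀ w, B w ∈ P := hraiseval B hΘB
  have hBP : ∀ p ∈ P, B p = 0 := hraiseP B hBΘ
  have hrangeP : LinearMap.range B ≤ P := by rintro _ ⟨w, rfl⟩; exact hBmem w
  have honto_of : ∀ B' ∈ 𝔊, Θ * B' = B' → B' * Θ = -B' → ¬ P ≤ LinearMap.range B' := by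
    intro B' hB' hΘB' hB'Θ hle
    obtain ⟨p, hp, hpne⟩ := hcon B' hB' hΘB' hB'Θ
    obtain ⟨w, hw⟩ := hle hp
    exact hpne w hw
  have hrk2 : Module.finrank ℂ (LinearMap.range B) = 2 := by
    have hlt : LinearMap.range B < P := lt_of_le_of_ne hrangeP fun h => honto_of B hB hΘB hBΘ h.symm.le
    have := Submodule.finrank_lt_finrank_of_lt hlt
    omega
  obtain ⟨C, hC, hBC⟩ := hadj B hB
  obtain ⟨hΘC, hCΘ⟩ := UnitaryTwoOdd.lower_of_adjoint hadd hsymm hΘΘ hP hQ hPQ hdefP hdefQ hΘB hBΘ hBC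
  have hCmem : ∀ w, C w ∈ Q := fun w => (hQ _).2 (by rw [← Module.End.mul_apply, hΘC, LinearMap.neg_apply])
  have hCQ : ∀ q ∈ Q, C q = 0 := fun q hq => by
    have h : C q = -(C q) := by
      conv_lhs => rw [← neg_neg q, ← (hQ q).1 hq, map_neg, ← Module.End.mul_apply, hCΘ]
    have h2 : (2 : ℂ) • C q = 0 := by rw [two_smul]; nth_rewrite 2 [h]; rw [add_neg_cancel]
    exact (smul_eq_zero.1 h2).resolve_left two_ne_zero
  obtain ⟨D, hD, hDΘ, hD1, hD2, hD3, hD4, hD5, hD6, hpos1, hpos2, hdec, hDs⟩ :=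
    UnitaryThreeCoprime.exists_projector_pair hbr hΘΘ hP hQ hadd hsymm hPQ hdefP hdefQ hB hC hΘB hBΘ hBC
  have hDP : ∀ p ∈ P, D p ∈ P := fun p hp => hrangeP (hD5 p hp).1
  have hDfix : ∀ x ∈ LinearMap.range B, D x = x := by rintro _ ⟨w, rfl⟩; exact hD1 w
  have hDDP : ∀ p ∈ P, D (D p) = D p := fun p hp => hDfix _ (hD5 p hp).1
  have hkerD : ∀ p ∈ P, D p = 0 → C p = 0 := fun p hp h => by
    have h' := (hD5 p hp).2; rwa [h, sub_zero] at h'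
  have hCinjR : ∀ x ∈ LinearMap.range B, C x = 0 → x = 0 := by rintro _ ⟨w, rfl⟩ h; exact hpos2 w h
  have hCD : ∀ p ∈ P, C p = C (D p) := fun p hp => by
    have h := (hD5 p hp).2; rw [map_sub, sub_eq_zero] at h; exact h
  -- STEP 2 (★): every raising operator maps `Q₀ = Q ∩ ker B` into `P₁ = B(W)`
  have hcommbr : ∀ X : Module.End ℂ W, Θ * X = X → X * Θ = -X →
      Θ * (D * X - X * D) = D * X - X * D ∧ (D * X - X * D) * Θ = -(D * X - X * D) := fun X h1 h2 =>
    ⟨by rw [mul_sub, ← mul_assoc, ← hDΘ, mul_assoc, h1, ← mul_assoc, h1],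
     by rw [sub_mul, mul_assoc, h2, mul_assoc, hDΘ, ← mul_assoc, h2, mul_neg, neg_mul, neg_sub_neg, neg_sub]⟩
  have hstar : ∀ B' ∈ 𝔊, Θ * B' = B' → B' * Θ = -B' → ∀ q ∈ Q, B q = 0 → D (B' q) = B' q := by
    intro B' hB' hΘB' hB'Θ
    by_contra hne
    push Not at hne
    obtain ⟨q₀, hq₀Q, hBq₀, hneq⟩ := hne
    have hB'P : ∀ p ∈ P, B' p = 0 := hraiseP B' hB'Θ
    have hB'mem : ∀ w, B' w ∈ P := hraiseval B' hΘB'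
    set N : Module.End ℂ W := D * B' - B' * D with hNdef
    obtain ⟨hΘN, hNΘ⟩ : Θ * N = N ∧ N * Θ = -N := hcommbr B' hΘB' hB'Θ
    set N₂ : Module.End ℂ W := D * N - N * D with hN₂def
    obtain ⟨hΘN₂, hN₂Θ⟩ : Θ * N₂ = N₂ ∧ N₂ * Θ = -N₂ := hcommbr N hΘN hNΘ
    have hNmem : N ∈ 𝔊 := hbr D hD B' hB'
    have hN₂mem : N₂ ∈ 𝔊 := hbr D hD N hNmem
    set B₀ : Module.End ℂ W := (2 : ℂ)⁻¹ • (N₂ - (3 : ℂ) • N + (2 : ℂ) • B') with hB₀def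
    have hB₀mem : B₀ ∈ 𝔊 := Submodule.smul_mem _ _ (Submodule.add_mem _ (Submodule.sub_mem _ hN₂mem
      (Submodule.smul_mem _ _ hNmem)) (Submodule.smul_mem _ _ hB'))
    have hΘB₀ : Θ * B₀ = B₀ := by
      rw [hB₀def, mul_smul_comm, mul_add, mul_sub, mul_smul_comm, mul_smul_comm, hΘN₂, hΘN, hΘB']
    have hB₀Θ : B₀ * Θ = -B₀ := by
      rw [hB₀def, smul_mul_assoc, add_mul, sub_mul, smul_mul_assoc, smul_mul_assoc, hN₂Θ, hNΘ, hB'Θ]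
      module
    -- values of `N`, `N₂`, `B₀`
    have hNq : ∀ q ∈ Q, B q = 0 → N q = D (B' q) := fun q hq hBq => by
      rw [hNdef, LinearMap.sub_apply, Module.End.mul_apply, Module.End.mul_apply, hD4 q hq hBq, map_zero, sub_zero]
    have hNP : ∀ p ∈ P, N p = 0 := fun p hp => by
      rw [hNdef, LinearMap.sub_apply, Module.End.mul_apply, Module.End.mul_apply, hB'P p hp, map_zero,
        hB'P _ (hDP p hp), sub_zero]
    have hNC : ∀ p ∈ P, N (C p) = D (B' (C p)) + B' (C p) := fun p hp => by
      rw [hNdef, LinearMap.sub_apply, Module.End.mul_apply, Module.End.mul_apply, hD3 p hp, map_neg, sub_neg_eq_add]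
    have hN₂q : ∀ q ∈ Q, B q = 0 → N₂ q = D (B' q) := fun q hq hBq => by
      rw [hN₂def, LinearMap.sub_apply, Module.End.mul_apply, Module.End.mul_apply, hNq q hq hBq, hD4 q hq hBq,
        map_zero, sub_zero, hDDP _ (hB'mem q)]
    have hN₂C : ∀ p ∈ P, N₂ (C p) = D (B' (C p)) + D (B' (C p)) + (D (B' (C p)) + B' (C p)) := fun p hp => by
      rw [hN₂def, LinearMap.sub_apply, Module.End.mul_apply, Module.End.mul_apply, hNC p hp, hD3 p hp, map_neg,
        hNC p hp, map_add, hDDP _ (hB'mem _), sub_neg_eq_add]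
    have hB₀q : ∀ q ∈ Q, B q = 0 → B₀ q = B' q - D (B' q) := fun q hq hBq => by
      rw [hB₀def, LinearMap.smul_apply, LinearMap.add_apply, LinearMap.sub_apply, LinearMap.smul_apply,
        LinearMap.smul_apply, hN₂q q hq hBq, hNq q hq hBq]
      module
    have hB₀C : ∀ p ∈ P, B₀ (C p) = 0 := fun p hp => by
      rw [hB₀def, LinearMap.smul_apply, LinearMap.add_apply, LinearMap.sub_apply, LinearMap.smul_apply,
        LinearMap.smul_apply, hN₂C p hp, hNC p hp]
      module
    -- `B + B₀` is raising and maps onto `P`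
    have hsum_mem : B + B₀ ∈ 𝔊 := Submodule.add_mem _ hB hB₀mem
    have hΘsum : Θ * (B + B₀) = B + B₀ := by rw [mul_add, hΘB, hΘB₀]
    have hsumΘ : (B + B₀) * Θ = -(B + B₀) := by rw [add_mul, hBΘ, hB₀Θ, neg_add]
    set x₀ := B' q₀ - D (B' q₀) with hx₀def
    have hx₀P : x₀ ∈ P := Submodule.sub_mem _ (hB'mem q₀) (hDP _ (hB'mem q₀))
    have hx₀0 : x₀ ≠ 0 := fun h => hneq (by rw [hx₀def, sub_eq_zero] at h; exact h.symm)
    have hx₀nr : x₀ ∉ LinearMap.range B := fun h => by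
      have h1 := hDfix x₀ h
      rw [hx₀def, map_sub, hDDP _ (hB'mem q₀), sub_self] at h1
      exact hx₀0 h1.symm
    have hx₀val : (B + B₀) q₀ = x₀ := by
      rw [LinearMap.add_apply, hBq₀, zero_add, hB₀q q₀ hq₀Q hBq₀]
    have hrange1 : LinearMap.range B ≤ LinearMap.range (B + B₀) := by
      rintro _ ⟨w, rfl⟩
      set q := (2 : ℂ)⁻¹ • (w - Θ w) with hqdef
      obtain ⟨hDq, hBq⟩ := hD6 q (hQhat w)
      obtain ⟨p', hp', hp'q⟩ := hDq
      refine ⟨-(D q), ?_⟩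
      have hBw : B w = B q := by
        conv_lhs => rw [← hsplit w, map_add, hBP _ (hPhat w), zero_add]
      rw [LinearMap.add_apply, map_neg, map_neg, ← hp'q, hB₀C p' hp', neg_zero, add_zero, hp'q, hBw]
      rw [map_add] at hBq
      rw [← neg_eq_of_add_eq_zero_right hBq, neg_neg]
    have hrange2 : LinearMap.range B ⊔ (ℂ ∙ x₀) ≤ LinearMap.range (B + B₀) :=
      sup_le hrange1 ((Submodule.span_singleton_le_iff_mem _ _).2 ⟨q₀, hx₀val⟩)
    have hinf : LinearMap.range B ⊓ (ℂ ∙ x₀) = ⊥ := by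
      rw [eq_bot_iff]
      rintro y ⟨hy1, hy2⟩
      rw [Submodule.mem_bot]
      obtain ⟨c, rfl⟩ := Submodule.mem_span_singleton.1 hy2
      by_cases hc : c = 0
      · rw [hc, zero_smul]
      · exact absurd (by
          have := Submodule.smul_mem _ c⁻¹ hy1
          rwa [smul_smul, inv_mul_cancel₀ hc, one_smul] at this) hx₀nr
    have hfin3 : Module.finrank ℂ ↥(LinearMap.range B ⊔ (ℂ ∙ x₀)) = 3 := by
      have h := Submodule.finrank_sup_add_finrank_inf_eq (LinearMap.range B) (ℂ ∙ x₀)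
      rw [hinf, finrank_bot, add_zero, hrk2, finrank_span_singleton hx₀0] at h
      omega
    have hPeq : LinearMap.range B ⊔ (ℂ ∙ x₀) = P :=
      Submodule.eq_of_le_of_finrank_le (sup_le hrangeP ((Submodule.span_singleton_le_iff_mem _ _).2 hx₀P))
        (by rw [hP3, hfin3])
    exact honto_of (B + B₀) hsum_mem hΘsum hsumΘ (hPeq ▸ hrange2)
  have hstar' : ∀ B' ∈ 𝔊, Θ * B' = B' → B' * Θ = -B' → ∀ q ∈ Q, B q = 0 → B' q ∈ LinearMap.range B :=
    fun B' hB' h1 h2 q hq hBq => hstar B' hB' h1 h2 q hq hBq ▸ (hD5 _ (hraiseval B' h1 q)).1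
  -- STEP 3 (♣)
  have hclub : ∀ B' ∈ 𝔊, Θ * B' = B' → B' * Θ = -B' → ∀ B'' ∈ 𝔊, Θ * B'' = B'' → B'' * Θ = -B'' →
      ∀ q ∈ Q, B q = 0 → D (B' (C (B'' q)) + B'' (C (B' q))) = B' (C (B'' q)) + B'' (C (B' q)) := by
    intro B' hB' hΘB' hB'Θ B'' hB'' hΘB'' hB''Θ q hq hBq
    set M : Module.End ℂ W := B' * C - C * B' with hMdef
    have hMmem : M ∈ 𝔊 := hbr B' hB' C hC
    have hMΘ : M * Θ = Θ * M := by
      rw [hMdef, sub_mul, mul_sub, mul_assoc, hCΘ, mul_assoc, hB'Θ, ← mul_assoc, hΘB', ← mul_assoc, hΘC, mul_neg,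
        neg_mul]
    set R : Module.End ℂ W := M * B'' - B'' * M with hRdef
    have hRmem : R ∈ 𝔊 := hbr M hMmem B'' hB''
    have hΘR : Θ * R = R := by
      rw [hRdef, mul_sub, ← mul_assoc, ← hMΘ, mul_assoc, hΘB'', ← mul_assoc, hΘB'']
    have hRΘ : R * Θ = -R := by
      rw [hRdef, sub_mul, mul_assoc, hB''Θ, mul_assoc, hMΘ, ← mul_assoc, hB''Θ, mul_neg, neg_mul, neg_sub_neg, neg_sub]
    have h := hstar R hRmem hΘR hRΘ q hq hBq
    have hRq : R q = B' (C (B'' q)) + B'' (C (B' q)) := by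
      rw [hRdef, LinearMap.sub_apply, Module.End.mul_apply, Module.End.mul_apply, hMdef, LinearMap.sub_apply,
        LinearMap.sub_apply, Module.End.mul_apply, Module.End.mul_apply, Module.End.mul_apply, Module.End.mul_apply,
        hraiseP B' hB'Θ _ (hraiseval B'' hΘB'' q), map_zero, sub_zero, hCQ q hq, map_zero, zero_sub, map_neg,
        sub_neg_eq_add]
    rwa [hRq] at h
  -- STEP 4: `P₀ = ℂη`, a basis `e` of `P₁`, coordinates `φⱼ` on `Q₁ = C(P₁)`
  have hfinP₀ : Module.finrank ℂ ↥(P ⊓ LinearMap.ker C) = 1 := by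
    have hsup : (P ⊓ LinearMap.ker C) ⊔ LinearMap.range B = P := by
      apply le_antisymm (sup_le inf_le_left hrangeP)
      intro p hp
      obtain ⟨hDp, hCp⟩ := hD5 p hp
      have h : p = (p - D p) + D p := by abel
      rw [h]
      exact Submodule.add_mem _ (Submodule.mem_sup_left (Submodule.mem_inf.2
        ⟨Submodule.sub_mem _ hp (hrangeP hDp), LinearMap.mem_ker.2 hCp⟩)) (Submodule.mem_sup_right hDp)
    have hinf : (P ⊓ LinearMap.ker C) ⊓ LinearMap.range B = ⊥ := by
      rw [eq_bot_iff]
      rintro x ⟨⟨-, hxC⟩, hxr⟩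
      rw [Submodule.mem_bot]
      exact hCinjR x hxr (LinearMap.mem_ker.1 hxC)
    have h := Submodule.finrank_sup_add_finrank_inf_eq (P ⊓ LinearMap.ker C) (LinearMap.range B)
    rw [hsup, hinf, finrank_bot, add_zero, hP3, hrk2] at h
    omega
  obtain ⟨⟨η, hηmem⟩, hη0⟩ := Module.finrank_pos_iff_exists_ne_zero.1
    (show 0 < Module.finrank ℂ ↥(P ⊓ LinearMap.ker C) by omega)
  have hη0' : η ≠ 0 := fun h => hη0 (Subtype.ext h)
  obtain ⟨hηP, hηC⟩ := Submodule.mem_inf.1 hηmem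
  have hCη : C η = 0 := LinearMap.mem_ker.1 hηC
  have hDη : D η = 0 := hD2 η hηP hCη
  have hΘη : Θ η = η := (hP η).1 hηP
  have hDker : ∀ x ∈ P, D x = 0 → x ∈ ℂ ∙ η := fun x hx hDx =>
    UnitaryTwoOdd.mem_span_of_finrank_le_one (S := P ⊓ LinearMap.ker C) (by omega) hηmem
      (Submodule.mem_inf.2 ⟨hx, LinearMap.mem_ker.2 (hkerD x hx hDx)⟩) hη0'
  have hηnr : ∀ c : ℂ, c • η ∈ LinearMap.range B → c • η = 0 := fun c h => by
    have h1 := hDfix _ h; rw [map_smul, hDη, smul_zero] at h1; exact h1.symm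
  set e := Module.finBasisOfFinrankEq ℂ ↥(LinearMap.range B) hrk2 with hedef
  set gC : ↥(LinearMap.range B) →ₗ[ℂ] W := C ∘ₗ (LinearMap.range B).subtype with hgCdef
  have hgCapply : ∀ x : LinearMap.range B, gC x = C x := fun x => rfl
  have hgCinj : Function.Injective gC := by
    intro x y hxy
    apply Subtype.ext
    have h : C ((x : W) - y) = 0 := by rw [map_sub, sub_eq_zero]; exact hxy
    exact sub_eq_zero.1 (hCinjR _ (Submodule.sub_mem _ x.2 y.2) h)
  obtain ⟨Kc, hKc⟩ := Submodule.exists_isCompl (LinearMap.range gC)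
  set proj : W →ₗ[ℂ] ↥(LinearMap.range B) := LinearMap.linearProjOfIsCompl Kc gC hgCinj hKc with hprojdef
  have hproj : ∀ x : LinearMap.range B, proj (C x) = x := fun x =>
    LinearMap.linearProjOfIsCompl_apply_left Kc gC hgCinj hKc x
  set φ : Fin 2 → Module.Dual ℂ W := fun j => (e.coord j) ∘ₗ proj with hφdef
  have hφ : ∀ j, ∀ x : LinearMap.range B, φ j (C x) = e.repr x j := fun j x => by
    rw [hφdef]; dsimp only; rw [LinearMap.comp_apply, hproj, Module.Basis.coord_apply]
  -- STEP 5: the involution `Θ' = 2D − Θ` and its Levi instance on `{Θ' = −1} = P₀ ⊕ Q₁`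
  set Θ' : Module.End ℂ W := (2 : ℂ) • D - Θ with hΘ'def
  have hΘ'mem : Θ' ∈ 𝔊 := Submodule.sub_mem _ (Submodule.smul_mem _ _ hD) hΘ
  have hΘ'apply : ∀ w, Θ' w = D w + D w - Θ w := fun w => by
    rw [hΘ'def, LinearMap.sub_apply, LinearMap.smul_apply, two_smul]
  have hΘ'a : ∀ a ∈ LinearMap.range B, Θ' a = a := fun a ha => by
    rw [hΘ'apply, hDfix a ha, (hP a).1 (hrangeP ha)]; abel
  have hΘ'b : ∀ b ∈ P ⊓ LinearMap.ker C, Θ' b = -b := fun b hb => by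
    obtain ⟨hbP, hbC⟩ := Submodule.mem_inf.1 hb
    rw [hΘ'apply, hD2 b hbP (LinearMap.mem_ker.1 hbC), (hP b).1 hbP]; abel
  have hΘ'c : ∀ c ∈ P.map C, Θ' c = -c := fun c hc => by
    obtain ⟨p, hp, rfl⟩ := hc
    rw [hΘ'apply, hD3 p hp, (hQ _).1 (hCmem p)]; abel
  have hΘ'd : ∀ d ∈ Q ⊓ LinearMap.ker B, Θ' d = d := fun d hd => by
    obtain ⟨hdQ, hdB⟩ := Submodule.mem_inf.1 hd
    rw [hΘ'apply, hD4 d hdQ (LinearMap.mem_ker.1 hdB), (hQ d).1 hdQ]; abel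
  have hΘ'Θ' : Θ' * Θ' = 1 := by
    refine LinearMap.ext fun w => ?_
    obtain ⟨a, ha, b, hb, c, hc, d, hd, rfl⟩ := hdec w
    have h1 : Θ' (a + b + c + d) = a - b - c + d := by
      rw [map_add, map_add, map_add, hΘ'a a ha, hΘ'b b hb, hΘ'c c hc, hΘ'd d hd]; abel
    have h2 : Θ' (a - b - c + d) = a + b + c + d := by
      rw [map_add, map_sub, map_sub, hΘ'a a ha, hΘ'b b hb, hΘ'c c hc, hΘ'd d hd]; abel
    rw [Module.End.mul_apply, Module.End.one_apply, h1, h2]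
  have h12 : Θ' * Θ = Θ * Θ' := by
    rw [hΘ'def, sub_mul, mul_sub, smul_mul_assoc, mul_smul_comm, hDΘ]
  have hΘ's : ∀ x y, s (Θ' x) y = s x (Θ' y) := fun x y => by
    rw [hΘ'apply, hΘ'apply, hsubl, hadd, hsubr, haddr, hDs, hΘs]
  set U'' : Submodule ℂ W := LinearMap.ker (Θ' + 1) with hU''def
  have hU'' : ∀ x, x ∈ U'' ↔ Θ' x = -x := fun x => by
    rw [hU''def, LinearMap.mem_ker, LinearMap.add_apply, Module.End.one_apply, add_eq_zero_iff_eq_neg]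
  have hPUle : P ⊓ LinearMap.ker C ≤ U'' := fun b hb => (hU'' b).2 (hΘ'b b hb)
  have hQUle : P.map C ≤ U'' := fun c hc => (hU'' c).2 (hΘ'c c hc)
  have hPUmem : ∀ x ∈ U'', Θ x = x → x ∈ P ⊓ LinearMap.ker C := fun x hxU hΘx => by
    have hxP : x ∈ P := (hP x).2 hΘx
    have h := (hU'' x).1 hxU
    rw [hΘ'apply, hΘx, sub_eq_iff_eq_add, neg_add_cancel, ← two_smul ℂ, smul_eq_zero] at h
    exact Submodule.mem_inf.2 ⟨hxP, LinearMap.mem_ker.2 (hkerD x hxP (h.resolve_left two_ne_zero))⟩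
  have hPUΘ : ∀ x ∈ P ⊓ LinearMap.ker C, Θ x = x := fun x hx => (hP x).1 (Submodule.mem_inf.1 hx).1
  have hQUmem : ∀ x ∈ U'', Θ x = -x → x ∈ P.map C := fun x hxU hΘx => by
    have hxQ : x ∈ Q := (hQ x).2 hΘx
    have h := (hU'' x).1 hxU
    rw [hΘ'apply, hΘx, sub_neg_eq_add, ← sub_eq_zero] at h
    have h' : (2 : ℂ) • (D x + x) = 0 := by rw [two_smul, ← h]; abel
    rw [smul_eq_zero] at h'
    have hDx : D x = -x := eq_neg_of_add_eq_zero_left (h'.resolve_left two_ne_zero)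
    have := (hD6 x hxQ).1
    rw [hDx] at this
    simpa using Submodule.neg_mem _ this
  have hQUΘ : ∀ x ∈ P.map C, Θ x = -x := fun x hx => by
    obtain ⟨p, hp, rfl⟩ := hx; exact (hQ _).1 (hCmem p)
  have hPUQU : ∀ x ∈ P ⊓ LinearMap.ker C, ∀ y ∈ P.map C, s x y = 0 := fun x hx y hy => by
    obtain ⟨p, hp, rfl⟩ := hy; exact hPQ _ (Submodule.mem_inf.1 hx).1 _ (hCmem p)
  have hdefPU : ∀ x ∈ P ⊓ LinearMap.ker C, s x x = 0 → x = 0 := fun x hx h => hdefP x (Submodule.mem_inf.1 hx).1 h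
  have hdefQU : ∀ y ∈ P.map C, s y y = 0 → y = 0 := fun y hy h => by
    obtain ⟨p, hp, rfl⟩ := hy; exact hdefQ _ (hCmem p) h
  -- `dim C(P) = 2`, `dim (Q ∩ ker B) = dim Q − 2 ≥ 2`
  have hmapC : P.map C = LinearMap.range gC := by
    apply le_antisymm
    · rintro _ ⟨p, hp, rfl⟩
      exact ⟨⟨D p, (hD5 p hp).1⟩, by rw [hgCapply, ← hCD p hp]⟩
    · rintro _ ⟨x, rfl⟩
      exact ⟨x, hrangeP x.2, rfl⟩
  have hfinQU : Module.finrank ℂ ↥(P.map C) = 2 := by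
    rw [hmapC, LinearMap.finrank_range_of_inj hgCinj, hrk2]
  have hfinQ₀ : Module.finrank ℂ ↥(Q ⊓ LinearMap.ker B) + 2 = Module.finrank ℂ Q := by
    have hsup : (Q ⊓ LinearMap.ker B) ⊔ P.map C = Q := by
      apply le_antisymm (sup_le inf_le_left (by rintro _ ⟨p, hp, rfl⟩; exact hCmem p))
      intro q hq
      obtain ⟨hDq, hBq⟩ := hD6 q hq
      have h : q = (q + D q) + (-(D q)) := by abel
      rw [h]
      refine Submodule.add_mem _ (Submodule.mem_sup_left (Submodule.mem_inf.2 ⟨Submodule.add_mem _ hq ?_,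
        LinearMap.mem_ker.2 hBq⟩)) (Submodule.mem_sup_right (Submodule.neg_mem _ hDq))
      obtain ⟨p, hp, hpq⟩ := hDq
      rw [← hpq]; exact hCmem p
    have hinf : (Q ⊓ LinearMap.ker B) ⊓ P.map C = ⊥ := by
      rw [eq_bot_iff]
      rintro x ⟨⟨-, hxB⟩, ⟨p, hp, rfl⟩⟩
      rw [Submodule.mem_bot]
      exact hpos1 p hp (LinearMap.mem_ker.1 hxB)
    have h := Submodule.finrank_sup_add_finrank_inf_eq (Q ⊓ LinearMap.ker B) (P.map C)
    rw [hsup, hinf, finrank_bot, add_zero, hfinQU] at h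
    exact h.symm
  -- the Levi instance: every endomorphism of `U''` is a restriction
  have hLevi := UnitaryThreeCoprime.levi_instance hbr hirr hΘΘ hP hQ hadd hsymm hPQ hdefP hdefQ hadj hΘ'mem hΘ'Θ'
    hΘ's hΘ hΘΘ h12 hU'' hPUle hQUle hPUmem hPUΘ hQUmem hQUΘ hPUQU hdefPU hdefQU
    (fun 𝔩 ι P' Q' hbr𝔩 hirr𝔩 hι hιι hP' hQ' hfinP' hfinQ' hP'Q' hdefP' hdefQ' hadj𝔩 =>
      UnitaryTwoOdd.eq_top' hbr𝔩 hirr𝔩 hι hιι hP' hQ' (by rw [hfinP', hfinP₀]; exact odd_one)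
        (by rw [hfinQ', hfinQU]) (s := fun x y : U'' => s (x : W) y)
        (fun x y z => by simp only [Submodule.coe_add, hadd]) (fun x y => hsymm x y) hP'Q' hdefP' hdefQ' hadj𝔩)
  -- STEP 6: the raising operators `B₁, B₂` with `Bⱼ(C x) = eⱼ^*(x) η`
  set ηU : U'' := ⟨η, hPUle hηmem⟩ with hηUdef
  have hZex : ∀ j : Fin 2, ∃ Z ∈ 𝔊, Z * Θ' = Θ' * Z ∧
      ∀ x : U'', ((((φ j) ∘ₗ U''.subtype).smulRight ηU x : U'') : W) = Z x := fun j => hLevi _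
  choose Z hZmem hZΘ' hZval using hZex
  have hZval' : ∀ j, ∀ x ∈ U'', Z j x = (φ j x) • η := fun j x hx => by
    have h := hZval j ⟨x, hx⟩
    rw [LinearMap.smulRight_apply, LinearMap.comp_apply, Submodule.subtype_apply, Submodule.coe_smul] at h
    exact h.symm
  obtain ⟨Bj, hBjdef⟩ : ∃ Bj : Fin 2 → Module.End ℂ W,
      ∀ j, Bj j = (4 : ℂ)⁻¹ • (Z j + Θ * Z j - Z j * Θ - Θ * Z j * Θ) := ⟨_, fun j => rfl⟩
  have hBjrel : ∀ j, Bj j ∈ 𝔊 ∧ Θ * Bj j = Bj j ∧ Bj j * Θ = -(Bj j) := fun j => by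
    rw [hBjdef j]; exact UnitaryThetaCore.raise_relations hbr hΘ hΘΘ (hZmem j)
  have hBjval : ∀ j, ∀ v ∈ P.map C, Bj j v = (φ j v) • η := fun j v hv => by
    have hvQ : Θ v = -v := hQUΘ v hv
    have hZv : Z j v = (φ j v) • η := hZval' j v (hQUle hv)
    have hΘZv : Θ (Z j v) = Z j v := by rw [hZv, map_smul, hΘη]
    rw [hBjdef j, LinearMap.smul_apply, LinearMap.sub_apply, LinearMap.sub_apply, LinearMap.add_apply,
      Module.End.mul_apply, Module.End.mul_apply, Module.End.mul_apply, Module.End.mul_apply, hvQ, map_neg, map_neg,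
      hΘZv, ← hZv]
    module
  have hBjC : ∀ j, ∀ x : LinearMap.range B, Bj j (C x) = (e.repr x j) • η := fun j x => by
    rw [hBjval j _ ⟨x, hrangeP x.2, rfl⟩, hφ]
  have hBjQ₀ : ∀ j, ∀ q ∈ Q, B q = 0 → Bj j q ∈ LinearMap.range B := fun j q hq hBq =>
    hstar' (Bj j) (hBjrel j).1 (hBjrel j).2.1 (hBjrel j).2.2 q hq hBq
  -- coordinates vanish ⟹ vector vanishes
  have hrepr0 : ∀ x : LinearMap.range B, e.repr x 0 = 0 → e.repr x 1 = 0 → (x : W) = 0 := fun x h0 h1 => by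
    have hx : x = 0 := e.ext_elem fun j => by
      fin_cases j
      · simpa using h0
      · simpa using h1
    rw [hx, Submodule.coe_zero]
  -- relations (♣) for `Bⱼ, Bₖ`
  have hrel : ∀ j k, ∀ q (hq : q ∈ Q) (hBq : B q = 0),
      e.repr ⟨Bj k q, hBjQ₀ k q hq hBq⟩ j + e.repr ⟨Bj j q, hBjQ₀ j q hq hBq⟩ k = 0 := by
    intro j k q hq hBq
    have h := hclub (Bj j) (hBjrel j).1 (hBjrel j).2.1 (hBjrel j).2.2 (Bj k) (hBjrel k).1 (hBjrel k).2.1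
      (hBjrel k).2.2 q hq hBq
    have h1 : Bj j (C (Bj k q)) = (e.repr ⟨Bj k q, hBjQ₀ k q hq hBq⟩ j) • η := hBjC j ⟨Bj k q, hBjQ₀ k q hq hBq⟩
    have h2 : Bj k (C (Bj j q)) = (e.repr ⟨Bj j q, hBjQ₀ j q hq hBq⟩ k) • η := hBjC k ⟨Bj j q, hBjQ₀ j q hq hBq⟩
    rw [h1, h2, ← add_smul, map_smul, hDη, smul_zero] at h
    exact (smul_eq_zero.1 h.symm).resolve_right hη0'
  -- STEP 7: every raising operator agrees on `Q₀` with a combination of `B₁, B₂`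
  have hcomb : ∀ B' ∈ 𝔊, Θ * B' = B' → B' * Θ = -B' →
      ∃ c₀ c₁ : ℂ, ∀ q ∈ Q, B q = 0 → B' q = c₀ • Bj 0 q + c₁ • Bj 1 q := by
    intro B' hB' hΘB' hB'Θ
    have hB'mem : ∀ w, B' w ∈ P := hraiseval B' hΘB'
    have hcex : ∀ j : Fin 2, ∃ c : ℂ, B' (C (e j : W)) - D (B' (C (e j : W))) = c • η := fun j => by
      have hx : B' (C (e j : W)) - D (B' (C (e j : W))) ∈ P :=
        Submodule.sub_mem _ (hB'mem _) (hDP _ (hB'mem _))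
      obtain ⟨c, hc⟩ := Submodule.mem_span_singleton.1 (hDker _ hx (by
        rw [map_sub, hDDP _ (hB'mem _), sub_self]))
      exact ⟨c, hc.symm⟩
    choose c hc using hcex
    refine ⟨c 0, c 1, ?_⟩
    set Bh : Module.End ℂ W := B' - c 0 • Bj 0 - c 1 • Bj 1 with hBhdef
    have hBhmem : Bh ∈ 𝔊 := Submodule.sub_mem _ (Submodule.sub_mem _ hB' (Submodule.smul_mem _ _ (hBjrel 0).1))
      (Submodule.smul_mem _ _ (hBjrel 1).1)
    have hΘBh : Θ * Bh = Bh := by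
      rw [hBhdef, mul_sub, mul_sub, mul_smul_comm, mul_smul_comm, hΘB', (hBjrel 0).2.1, (hBjrel 1).2.1]
    have hBhΘ : Bh * Θ = -Bh := by
      rw [hBhdef, sub_mul, sub_mul, smul_mul_assoc, smul_mul_assoc, hB'Θ, (hBjrel 0).2.2, (hBjrel 1).2.2, smul_neg,
        smul_neg]
      abel
    have hBhapply : ∀ w, Bh w = B' w - c 0 • Bj 0 w - c 1 • Bj 1 w := fun w => by
      rw [hBhdef, LinearMap.sub_apply, LinearMap.sub_apply, LinearMap.smul_apply, LinearMap.smul_apply]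
    -- `Bh` maps `C(P)` into `P₁`
    have hB'Cx : ∀ x : LinearMap.range B, B' (C x) = D (B' (C x)) + (e.repr x 0 * c 0 + e.repr x 1 * c 1) • η := by
      intro x
      have hx : (x : W) = e.repr x 0 • ((e 0 : LinearMap.range B) : W) + e.repr x 1 • ((e 1 : LinearMap.range B) : W) := by
        have h := congrArg Subtype.val (e.sum_repr x)
        rw [Fin.sum_univ_two, Submodule.coe_add, Submodule.coe_smul, Submodule.coe_smul] at h
        exact h.symm
      have h0 : B' (C (e 0 : W)) = D (B' (C (e 0 : W))) + c 0 • η := by rw [← hc 0]; abel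
      have h1 : B' (C (e 1 : W)) = D (B' (C (e 1 : W))) + c 1 • η := by rw [← hc 1]; abel
      rw [hx, map_add, map_smul, map_smul, map_add, map_smul, map_smul, h0, h1, map_add, map_smul, map_smul,
        map_add, map_add, map_smul, map_smul, hDDP _ (hB'mem _), hDDP _ (hB'mem _), hDη]
      module
    have hBhfix : ∀ p ∈ P, D (Bh (C p)) = Bh (C p) := fun p hp => by
      set x : LinearMap.range B := ⟨D p, (hD5 p hp).1⟩ with hxdef
      have hCp : C p = C x := hCD p hp
      rw [hCp, hBhapply, hB'Cx x, hBjC 0 x, hBjC 1 x, map_sub, map_sub, map_add, map_smul, map_smul, map_smul,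
        map_smul, map_smul, hDDP _ (hB'mem _), hDη]
      module
    -- hence `Bh` kills `Q₀`
    have hBhQ₀ : ∀ q ∈ Q, B q = 0 → Bh q = 0 := fun q hq hBq => by
      have hyr : Bh q ∈ LinearMap.range B := hstar' Bh hBhmem hΘBh hBhΘ q hq hBq
      set y : LinearMap.range B := ⟨Bh q, hyr⟩ with hydef
      have hcoord : ∀ j, e.repr y j = 0 := fun j => by
        have h := hclub (Bj j) (hBjrel j).1 (hBjrel j).2.1 (hBjrel j).2.2 Bh hBhmem hΘBh hBhΘ q hq hBq
        have h1 : Bj j (C (Bh q)) = (e.repr y j) • η := hBjC j y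
        have h2 : D (Bh (C (Bj j q))) = Bh (C (Bj j q)) := hBhfix _ (hraiseval _ (hBjrel j).2.1 q)
        rw [map_add, h2, add_left_inj, h1, map_smul, hDη, smul_zero] at h
        exact (smul_eq_zero.1 h.symm).resolve_right hη0'
      exact hrepr0 y (hcoord 0) (hcoord 1)
    intro q hq hBq
    have h := hBhQ₀ q hq hBq
    rw [hBhapply, sub_eq_zero, sub_eq_iff_eq_add] at h
    rw [h]; abel
  -- STEP 8: a non-zero vector of `Q₀` killed by `B₁` and `B₂`, hence by every raising operator
  set Q₀ : Submodule ℂ W := Q ⊓ LinearMap.ker B with hQ₀def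
  set L : ↥Q₀ →ₗ[ℂ] ℂ := (φ 0 ∘ₗ C ∘ₗ Bj 1) ∘ₗ Q₀.subtype with hLdef
  have hLker : LinearMap.ker L ≠ ⊥ := LinearMap.ker_ne_bot_of_finrank_lt (by rw [Module.finrank_self]; omega)
  obtain ⟨⟨q, hqQ₀⟩, hqker, hq0⟩ := (Submodule.ne_bot_iff _).1 hLker
  obtain ⟨hqQ, hqB⟩ := Submodule.mem_inf.1 hqQ₀
  have hBq : B q = 0 := LinearMap.mem_ker.1 hqB
  have hq0' : q ≠ 0 := fun h => hq0 (Subtype.ext h)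
  have hL0 : φ 0 (C (Bj 1 q)) = 0 := by
    have h := LinearMap.mem_ker.1 hqker
    rwa [hLdef, LinearMap.comp_apply, Submodule.subtype_apply, LinearMap.comp_apply, LinearMap.comp_apply] at h
  set y0 : LinearMap.range B := ⟨Bj 0 q, hBjQ₀ 0 q hqQ hBq⟩ with hy0def
  set y1 : LinearMap.range B := ⟨Bj 1 q, hBjQ₀ 1 q hqQ hBq⟩ with hy1def
  have h10 : e.repr y1 0 = 0 := by rw [← hφ 0 y1]; exact hL0
  have h11 : e.repr y1 1 = 0 := by
    have h := hrel 1 1 q hqQ hBq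
    rw [← two_mul, mul_eq_zero] at h
    exact h.resolve_left two_ne_zero
  have h00 : e.repr y0 0 = 0 := by
    have h := hrel 0 0 q hqQ hBq
    rw [← two_mul, mul_eq_zero] at h
    exact h.resolve_left two_ne_zero
  have h01 : e.repr y0 1 = 0 := by
    have h := hrel 0 1 q hqQ hBq
    rw [h10, zero_add] at h
    exact h
  have hB0q : Bj 0 q = 0 := hrepr0 y0 h00 h01
  have hB1q : Bj 1 q = 0 := hrepr0 y1 h10 h11
  refine hq0' (UnitaryThetaCore.eq_zero_of_forall_raise_apply_eq_zero hbr hirr hΘ hΘΘ hP0 ((hQ q).1 hqQ)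
    fun B' hB' hΘB' hB'Θ => ?_)
  obtain ⟨c₀, c₁, hc⟩ := hcomb B' hB' hΘB' hB'Θ
  rw [hc q hqQ hBq, hB0q, hB1q, smul_zero, smul_zero, add_zero]

end RankThree

/-! ### §6 The theorem -/

section Main

variable {W : Type*} [AddCommGroup W] [Module ℂ W]

universe u in
/-- The induction behind `UnitaryThreeCoprime.eq_top` (strong induction on `dim Q`, the type `W` generalized; the
inductive step is verbatim that of `UnitaryTwoOdd.eq_top`, with the rank-three raising lemma supplying the full-rank
pair). [cite: Ribet1983, Thm. 3] [cite: Gordon1997, §6 (proof of Thm. 6.3.3, pp. 18–19)] -/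
private theorem UnitaryThreeCoprime.eq_top_aux (b : ℕ) :
    ∀ {W : Type u} [AddCommGroup W] [Module ℂ W] [FiniteDimensional ℂ W]
      {𝔊 : Submodule ℂ (Module.End ℂ W)},
      (∀ Y ∈ 𝔊, ∀ Z ∈ 𝔊, Y * Z - Z * Y ∈ 𝔊) →
      (∀ U : Submodule ℂ W, (∀ A ∈ 𝔊, ∀ u ∈ U, A u ∈ U) → U = ⊥ ∨ U = ⊤) →
      ∀ {Θ : Module.End ℂ W}, Θ ∈ 𝔊 → Θ * Θ = 1 →
      ∀ {P Q : Submodule ℂ W}, (∀ x, x ∈ P ↔ Θ x = x) → (∀ x, x ∈ Q ↔ Θ x = -x) →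
      Module.finrank ℂ P = 3 → Module.finrank ℂ Q = b → ¬ 3 ∣ b →
      ∀ {s : W → W → ℂ}, (∀ x y z, s (x + y) z = s x z + s y z) →
      (∀ x y, s y x = starRingEnd ℂ (s x y)) →
      (∀ p ∈ P, ∀ q ∈ Q, s p q = 0) → (∀ p ∈ P, s p p = 0 → p = 0) → (∀ q ∈ Q, s q q = 0 → q = 0) →
      (∀ X ∈ 𝔊, ∃ Y ∈ 𝔊, ∀ x y, s (X x) y = s x (Y y)) → 𝔊 = ⊤ := by
  induction b using Nat.strong_induction_on with
  | _ b ih =>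
  intro W _ _ _ 𝔊 hbr hirr Θ hΘ hΘΘ P Q hP hQ hP3 hQb hb3 s hadd hsymm hPQ hdefP hdefQ hadj
  classical
  have hΘΘv : ∀ v, Θ (Θ v) = v := fun v => by rw [← Module.End.mul_apply, hΘΘ, Module.End.one_apply]
  have hPhat : ∀ w, (2 : ℂ)⁻¹ • (w + Θ w) ∈ P := fun w => (hP _).2 (by rw [map_smul, map_add, hΘΘv, add_comm])
  have hQhat : ∀ w, (2 : ℂ)⁻¹ • (w - Θ w) ∈ Q := fun w =>
    (hQ _).2 (by rw [map_smul, map_sub, hΘΘv, ← smul_neg, neg_sub])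
  have hsplit : ∀ w, (2 : ℂ)⁻¹ • (w + Θ w) + (2 : ℂ)⁻¹ • (w - Θ w) = w := fun w => by module
  obtain ⟨-, h0r, h0l, -, -, hsubr, -⟩ := UnitaryTwoOdd.herm_right hadd hsymm
  have hP0 : ∃ p : W, p ≠ 0 ∧ Θ p = p := by
    have hpos : 0 < Module.finrank ℂ P := by omega
    obtain ⟨⟨p, hp⟩, hp0⟩ := Module.finrank_pos_iff_exists_ne_zero.1 hpos
    exact ⟨p, fun h => hp0 (Subtype.ext h), (hP p).1 hp⟩
  have hraiseval : ∀ Z : Module.End ℂ W, Θ * Z = Z → ∀ w, Z w ∈ P := fun Z hΘZ w =>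
    (hP _).2 (by rw [← Module.End.mul_apply, hΘZ])
  -- `dim Q = 1`: the `(m, 1)` core; `dim Q = 2`: the `(odd, 2)` core (`dim Q ∈ {0, 3}` is excluded)
  by_cases hb1 : b = 1
  · exact UnitaryThreeCoprime.eq_top_of_finrank_eq_one hbr hirr hΘ hΘΘ hP hQ (by omega) (by rw [hQb, hb1])
  by_cases hb2 : b = 2
  · exact UnitaryTwoOdd.eq_top' hbr hirr hΘ hΘΘ hP hQ (by rw [hP3]; exact ⟨1, rfl⟩) (by rw [hQb, hb2]) hadd hsymm hPQ
      hdefP hdefQ hadj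
  have hb4 : 4 ≤ b := by
    have h0 : b ≠ 0 := fun h => hb3 (by rw [h]; exact dvd_zero 3)
    have h3 : b ≠ 3 := fun h => hb3 (by rw [h])
    omega
  -- STEP A: a rank-one idempotent in `𝔊`
  suffices hrank : ∃ (u : W) (φ : Module.Dual ℂ W), φ u = 1 ∧ φ.smulRight u ∈ 𝔊 by
    obtain ⟨u, φ, hφu, he⟩ := hrank
    exact UnitaryTwoOdd.eq_top_of_rankOne hbr hirr hφu he
  -- `dim Q ≥ 4`: the inductive case
  obtain ⟨B, hB, hΘB, hBΘ, honto⟩ := UnitaryThreeCoprime.exists_raise_onto_three hbr hirr hΘ hΘΘ hP hQ hP3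
    (by rw [hQb]; exact hb4) hadd hsymm hPQ hdefP hdefQ hadj
  obtain ⟨C, hC, hBC⟩ := hadj B hB
  obtain ⟨hΘC, hCΘ⟩ := UnitaryTwoOdd.lower_of_adjoint hadd hsymm hΘΘ hP hQ hPQ hdefP hdefQ hΘB hBΘ hBC
  have hinj := UnitaryTwoOdd.injOn_of_adjoint hadd hsymm hΘΘ hP hQ hPQ hdefP hdefQ hΘB hBΘ hBC honto
  obtain ⟨E, hE, hEP, hEW, hEK, hECP, hEker, hfinmap, hsup, hinf⟩ :=
    UnitaryTwoOdd.exists_idempotent_of_fullRank_pair hbr hΘ hΘΘ hP hQ hB hC hΘB hBΘ hΘC hCΘ hinj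
  set K : Submodule ℂ W := Q ⊓ LinearMap.ker (C * B) with hKdef
  have hKQ : K ≤ Q := inf_le_left
  have hmapQ : P.map C ≤ Q := le_sup_right.trans hsup.le
  have hCmem : ∀ w, C w ∈ Q := fun w => (hQ _).2 (by rw [← Module.End.mul_apply, hΘC, LinearMap.neg_apply])
  have hEQ : ∀ w, E w ∈ Q := fun w => hKQ (hEW w)
  have hEE : ∀ w, E (E w) = E w := fun w => hEK _ (hEW w)
  have hBK : ∀ k ∈ K, B k = 0 := fun k hk => by
    have hCBk : C (B k) = 0 := by
      have h := LinearMap.mem_ker.1 (Submodule.mem_inf.1 hk).2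
      rwa [Module.End.mul_apply] at h
    exact hdefP _ (hraiseval B hΘB k) (by rw [hBC, hCBk, h0r])
  have hCinj : ∀ p ∈ P, C p = 0 → p = 0 := fun p hp h0 => hinj p hp (by rw [h0, map_zero])
  -- `E` commutes with `Θ`
  have hEΘ : E * Θ = Θ * E := by
    refine LinearMap.ext fun w => ?_
    have hΘw : Θ w = (2 : ℂ)⁻¹ • (w + Θ w) - (2 : ℂ)⁻¹ • (w - Θ w) := by module
    rw [Module.End.mul_apply, Module.End.mul_apply, hΘw, map_sub, hEP _ (hPhat w), zero_sub,
      (hQ _).1 (hEQ w)]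
    conv_rhs => rw [← hsplit w, map_add, hEP _ (hPhat w), zero_add]
  -- dimensions
  have hfinK : Module.finrank ℂ K = b - 3 := by
    have h := Submodule.finrank_sup_add_finrank_inf_eq K (P.map C)
    rw [hsup, hinf, finrank_bot, add_zero, hfinmap, hP3, hQb] at h
    omega
  -- the Levi restriction algebra `𝔩 ⊆ End(Q)`
  set 𝔩 : Submodule ℂ (Module.End ℂ Q) :=
    { carrier := {A | ∃ Z ∈ 𝔊, Z * Θ = Θ * Z ∧ ∀ q : Q, ((A q : Q) : W) = Z q}
      zero_mem' := ⟨0, Submodule.zero_mem _, by rw [zero_mul, mul_zero], fun q => by simp⟩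
      add_mem' := by
        rintro A A' ⟨Z, hZ, hZΘ, hAZ⟩ ⟨Z', hZ', hZ'Θ, hAZ'⟩
        exact ⟨Z + Z', Submodule.add_mem _ hZ hZ', by rw [add_mul, mul_add, hZΘ, hZ'Θ], fun q => by
          rw [LinearMap.add_apply, Submodule.coe_add, hAZ, hAZ', LinearMap.add_apply]⟩
      smul_mem' := by
        rintro c A ⟨Z, hZ, hZΘ, hAZ⟩
        exact ⟨c • Z, Submodule.smul_mem _ c hZ, by rw [smul_mul_assoc, mul_smul_comm, hZΘ], fun q => by
          rw [LinearMap.smul_apply, Submodule.coe_smul, hAZ, LinearMap.smul_apply]⟩ } with h𝔩def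
  have hmem𝔩 : ∀ A, A ∈ 𝔩 ↔ ∃ Z ∈ 𝔊, Z * Θ = Θ * Z ∧ ∀ q : Q, ((A q : Q) : W) = Z q := fun A => Iff.rfl
  have hcommQ : ∀ Z : Module.End ℂ W, Z * Θ = Θ * Z → ∀ q ∈ Q, Z q ∈ Q := fun Z hZ q hq =>
    (hQ _).2 (by rw [← Module.End.mul_apply, ← hZ, Module.End.mul_apply, (hQ q).1 hq, map_neg])
  have hcommP : ∀ Z : Module.End ℂ W, Z * Θ = Θ * Z → ∀ p ∈ P, Z p ∈ P := fun Z hZ p hp =>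
    (hP _).2 (by rw [← Module.End.mul_apply, ← hZ, Module.End.mul_apply, (hP p).1 hp])
  have hres : ∀ Z ∈ 𝔊, Z * Θ = Θ * Z → ∃ A ∈ 𝔩, ∀ q : Q, ((A q : Q) : W) = Z q := fun Z hZ hZΘ =>
    ⟨Z.restrict fun q hq => hcommQ Z hZΘ q hq, ⟨Z, hZ, hZΘ, fun q => rfl⟩, fun q => rfl⟩
  have hbr𝔩 : ∀ A ∈ 𝔩, ∀ A' ∈ 𝔩, A * A' - A' * A ∈ 𝔩 := by
    intro A hA A' hA'
    obtain ⟨Z, hZ, hZΘ, hAZ⟩ := (hmem𝔩 A).1 hA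
    obtain ⟨Z', hZ', hZ'Θ, hAZ'⟩ := (hmem𝔩 A').1 hA'
    refine (hmem𝔩 _).2 ⟨Z * Z' - Z' * Z, hbr Z hZ Z' hZ', ?_, fun q => ?_⟩
    · rw [sub_mul, mul_sub, mul_assoc, hZ'Θ, ← mul_assoc, hZΘ, mul_assoc, mul_assoc, hZΘ, ← mul_assoc Z', hZ'Θ,
        mul_assoc]
    · rw [LinearMap.sub_apply, Submodule.coe_sub, Module.End.mul_apply, Module.End.mul_apply, hAZ, hAZ', hAZ',
        hAZ, LinearMap.sub_apply, Module.End.mul_apply, Module.End.mul_apply]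
  have hirr𝔩 := UnitaryTwoOdd.levi_irreducible hbr hirr hΘ hΘΘ hP hQ 𝔩 hres
  -- the idempotent `f = E|_Q` and the involution `T = 1 − 2f`
  set f : Module.End ℂ Q := E.restrict fun q (_ : q ∈ Q) => hEQ q with hfdef
  have hfapply : ∀ q : Q, ((f q : Q) : W) = E q := fun q => rfl
  have hff : f * f = f := LinearMap.ext fun q => Subtype.ext (by
    rw [Module.End.mul_apply, hfapply, hfapply, hEE])
  set T : Module.End ℂ Q := 1 - (f + f) with hTdef
  have hTapply : ∀ q : Q, ((T q : Q) : W) = (q : W) - (E q + E q) := fun q => by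
    rw [hTdef, LinearMap.sub_apply, Module.End.one_apply, LinearMap.add_apply, Submodule.coe_sub,
      Submodule.coe_add, hfapply]
  have hT𝔩 : T ∈ 𝔩 := by
    refine (hmem𝔩 T).2 ⟨-Θ - (E + E), Submodule.sub_mem _ (Submodule.neg_mem _ hΘ) (Submodule.add_mem _ hE hE),
      ?_, fun q => ?_⟩
    · rw [sub_mul, mul_sub, add_mul, mul_add, hEΘ, neg_mul, mul_neg]
    · rw [hTapply, LinearMap.sub_apply, LinearMap.neg_apply, LinearMap.add_apply, (hQ _).1 q.2, neg_neg]
  have hTT : T * T = 1 := LinearMap.ext fun q => Subtype.ext (by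
    rw [Module.End.mul_apply, Module.End.one_apply, hTapply, hTapply, map_sub, map_add, hEE]
    abel)
  -- its eigenspaces `P' = ker f` (`= C(P)`) and `Q' = range f` (`= K`)
  set P' : Submodule ℂ Q := LinearMap.ker f with hP'def
  set Q' : Submodule ℂ Q := LinearMap.range f with hQ'def
  have hP' : ∀ x, x ∈ P' ↔ T x = x := fun x => by
    rw [hP'def, LinearMap.mem_ker]
    constructor
    · intro h
      apply Subtype.ext
      rw [hTapply, ← hfapply, h, Submodule.coe_zero, add_zero, sub_zero]
    · intro h
      have h' := congrArg Subtype.val h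
      rw [hTapply, sub_eq_self, ← two_smul ℂ, smul_eq_zero] at h'
      exact Subtype.ext (by rw [hfapply]; exact h'.resolve_left two_ne_zero)
  have hQ'mem : ∀ x : Q, x ∈ Q' ↔ E x = x := fun x => by
    rw [hQ'def, LinearMap.mem_range]
    constructor
    · rintro ⟨y, rfl⟩
      rw [hfapply, hEE]
    · intro h
      exact ⟨x, Subtype.ext (by rw [hfapply, h])⟩
  have hQ' : ∀ x, x ∈ Q' ↔ T x = -x := fun x => by
    rw [hQ'mem]
    constructor
    · intro h
      apply Subtype.ext
      rw [hTapply, h, Submodule.coe_neg]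
      abel
    · intro h
      have h' := congrArg Subtype.val h
      rw [hTapply, Submodule.coe_neg] at h'
      have h3 := eq_neg_iff_add_eq_zero.1 h'
      have h2 : E x + E x = (x : W) + x := by
        rw [← sub_eq_zero, ← neg_eq_zero, ← h3]; abel
      rw [← two_smul ℂ (E (x : W)), ← two_smul ℂ (x : W)] at h2
      exact smul_right_injective W (two_ne_zero' ℂ) h2
  have hP'eq : P' = Submodule.comap Q.subtype (P.map C) := by
    ext x
    rw [hP'def, LinearMap.mem_ker, Submodule.mem_comap, Submodule.subtype_apply]
    constructor
    · intro h
      exact hEker x x.2 (by rw [← hfapply, h, Submodule.coe_zero])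
    · rintro ⟨p, hp, hpx⟩
      apply Subtype.ext
      rw [hfapply, Submodule.coe_zero, ← hpx, hECP p hp]
  have hQ'eq : Q' = Submodule.comap Q.subtype K := by
    ext x
    rw [hQ'mem, Submodule.mem_comap, Submodule.subtype_apply]
    constructor
    · intro h
      rw [← h]; exact hEW x
    · intro h
      exact hEK x h
  have hfinP' : Module.finrank ℂ P' = 3 := by
    rw [hP'eq, (Submodule.comapSubtypeEquivOfLe hmapQ).finrank_eq, hfinmap, hP3]
  have hfinQ' : Module.finrank ℂ Q' = b - 3 := by
    rw [hQ'eq, (Submodule.comapSubtypeEquivOfLe hKQ).finrank_eq, hfinK]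
  -- the Hermitian data on `Q`
  have hP'Q' : ∀ p' ∈ P', ∀ q' ∈ Q', s (p' : W) q' = 0 := by
    intro p' hp' q' hq'
    rw [hP'eq] at hp'
    obtain ⟨p, hp, hpp'⟩ := hp'
    rw [hQ'eq] at hq'
    have hBq' : B q' = 0 := hBK _ hq'
    rw [Submodule.subtype_apply] at hpp'
    rw [← hpp', hsymm, ← hBC, hBq', h0l, map_zero]
  have hadj𝔩 : ∀ A ∈ 𝔩, ∃ A' ∈ 𝔩, ∀ x y : Q, s ((A x : Q) : W) y = s x ((A' y : Q) : W) := by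
    intro A hA
    obtain ⟨Z, hZ, hZΘ, hAZ⟩ := (hmem𝔩 A).1 hA
    obtain ⟨Z', hZ', hZZ'⟩ := hadj Z hZ
    have hΘs := UnitaryTwoOdd.theta_selfAdjoint hadd hsymm hΘΘ hP hQ hPQ
    have hZ'Θ : Z' * Θ = Θ * Z' := by
      refine LinearMap.ext fun y => ?_
      rw [← sub_eq_zero, ← LinearMap.sub_apply]
      refine UnitaryTwoOdd.eq_zero_of_forall_left hadd hsymm hΘΘ hP hQ hPQ hdefP hdefQ fun x => ?_
      rw [LinearMap.sub_apply, hsubr, Module.End.mul_apply, Module.End.mul_apply, ← hZZ', ← hΘs, ← hΘs, ← hZZ',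
        ← Module.End.mul_apply, ← Module.End.mul_apply, hZΘ, sub_self]
    obtain ⟨A', hA', hA'Z'⟩ := hres Z' hZ' hZ'Θ
    exact ⟨A', hA', fun x y => by rw [hAZ, hA'Z', hZZ']⟩
  -- induction: `𝔩 = End(Q)`
  have hb3lt : b - 3 < b := by omega
  have hb3' : ¬ 3 ∣ (b - 3) := by omega
  have h𝔩top : 𝔩 = ⊤ :=
    ih (b - 3) hb3lt hbr𝔩 hirr𝔩 hT𝔩 hTT hP' hQ' hfinP' hfinQ' hb3' (s := fun x y : Q => s (x : W) y)
      (fun x y z => by simp only [Submodule.coe_add, hadd]) (fun x y => hsymm x y) hP'Q'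
      (fun p _ h => Subtype.ext (hdefQ _ p.2 h)) (fun q _ h => Subtype.ext (hdefQ _ q.2 h)) hadj𝔩
  -- the `𝔑`-trick
  set 𝔑 : Submodule ℂ (Module.End ℂ Q) :=
    { carrier := {Y | ∃ N ∈ 𝔊, (∀ p ∈ P, N p = 0) ∧ ∀ q : Q, ((Y q : Q) : W) = N q}
      zero_mem' := ⟨0, Submodule.zero_mem _, fun p _ => rfl, fun q => by simp⟩
      add_mem' := by
        rintro Y Y' ⟨N, hN, hNP, hYN⟩ ⟨N', hN', hN'P, hYN'⟩
        exact ⟨N + N', Submodule.add_mem _ hN hN', fun p hp => by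
          rw [LinearMap.add_apply, hNP p hp, hN'P p hp, add_zero], fun q => by
          rw [LinearMap.add_apply, Submodule.coe_add, hYN, hYN', LinearMap.add_apply]⟩
      smul_mem' := by
        rintro c Y ⟨N, hN, hNP, hYN⟩
        exact ⟨c • N, Submodule.smul_mem _ c hN, fun p hp => by rw [LinearMap.smul_apply, hNP p hp, smul_zero],
          fun q => by rw [LinearMap.smul_apply, Submodule.coe_smul, hYN, LinearMap.smul_apply]⟩ } with h𝔑def
  have hmem𝔑 : ∀ Y, Y ∈ 𝔑 ↔ ∃ N ∈ 𝔊, (∀ p ∈ P, N p = 0) ∧ ∀ q : Q, ((Y q : Q) : W) = N q := fun Y => Iff.rfl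
  have hf𝔑 : f ∈ 𝔑 := (hmem𝔑 f).2 ⟨E, hE, hEP, hfapply⟩
  have had : ∀ A : Module.End ℂ Q, ∀ Y ∈ 𝔑, A * Y - Y * A ∈ 𝔑 := by
    intro A Y hY
    obtain ⟨Z, hZ, hZΘ, hAZ⟩ := (hmem𝔩 A).1 (h𝔩top ▸ Submodule.mem_top)
    obtain ⟨N, hN, hNP, hYN⟩ := (hmem𝔑 Y).1 hY
    refine (hmem𝔑 _).2 ⟨Z * N - N * Z, hbr Z hZ N hN, fun p hp => ?_, fun q => ?_⟩
    · rw [LinearMap.sub_apply, Module.End.mul_apply, Module.End.mul_apply, hNP p hp, map_zero,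
        hNP _ (hcommP Z hZΘ p hp), sub_zero]
    · rw [LinearMap.sub_apply, Submodule.coe_sub, Module.End.mul_apply, Module.End.mul_apply, hAZ, hYN, hYN, hAZ,
        LinearMap.sub_apply, Module.End.mul_apply, Module.End.mul_apply]
  have hf0 : f ≠ 0 := by
    have hKpos : 0 < Module.finrank ℂ K := by rw [hfinK]; omega
    obtain ⟨⟨k, hk⟩, hk0⟩ := Module.finrank_pos_iff_exists_ne_zero.1 hKpos
    intro hf
    apply hk0
    apply Subtype.ext
    have h := hfapply ⟨k, hKQ hk⟩
    rw [hf, LinearMap.zero_apply, Submodule.coe_zero, hEK k hk] at h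
    exact h.symm
  have hf1 : f ≠ 1 := by
    obtain ⟨p₀, hp₀0, hp₀⟩ := hP0
    have hp₀P : p₀ ∈ P := (hP p₀).2 hp₀
    intro hf
    have h := hfapply ⟨C p₀, hCmem p₀⟩
    rw [hf, Module.End.one_apply, hECP p₀ hp₀P] at h
    exact hp₀0 (hCinj p₀ hp₀P h)
  obtain ⟨u, φ, hφu, hφ𝔑⟩ := UnitaryTwoOdd.exists_rankOne_of_adStable 𝔑 had hf𝔑 hff hf0 hf1
  obtain ⟨N, hN, hNP, hNq⟩ := (hmem𝔑 _).1 hφ𝔑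
  -- `N = (φ ∘ π_Q) ⊗ u` is a rank-one idempotent of `W` in `𝔊`
  set πQ : W →ₗ[ℂ] Q := LinearMap.codRestrict Q ((2 : ℂ)⁻¹ • ((1 : Module.End ℂ W) - Θ)) fun w => by
    rw [LinearMap.smul_apply, LinearMap.sub_apply, Module.End.one_apply]; exact hQhat w with hπQdef
  have hπapply : ∀ w, (πQ w : W) = (2 : ℂ)⁻¹ • (w - Θ w) := fun w => rfl
  have hπq : ∀ q : Q, πQ q = q := fun q => Subtype.ext (by
    rw [hπapply, (hQ _).1 q.2, sub_neg_eq_add, ← two_smul ℂ (q : W), smul_smul, inv_mul_cancel₀ two_ne_zero,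
      one_smul])
  refine ⟨u, φ ∘ₗ πQ, by rw [LinearMap.comp_apply, hπq, hφu], ?_⟩
  have hNeq : (φ ∘ₗ πQ).smulRight (u : W) = N := by
    refine LinearMap.ext fun w => ?_
    rw [LinearMap.smulRight_apply, LinearMap.comp_apply]
    conv_rhs => rw [← hsplit w, map_add, hNP _ (hPhat w), zero_add]
    have h := hNq (πQ w)
    rw [LinearMap.smulRight_apply, Submodule.coe_smul] at h
    rw [h, hπapply]
  rw [hNeq]
  exact hN

/-- **THE `Θ`-SUBALGEBRA THEOREM FOR UNITARY MULTIPLICITIES `(3, b)`, `3 ∤ b` — complex Hermitian core.** Let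
`𝔊 ⊆ End(W)` be bracket-closed and act irreducibly, `Θ ∈ 𝔊` an involution with eigenspaces `P` (`dim P = 3`) and `Q`
(`3 ∤ dim Q`), and let `s` be a Hermitian function on `W`, additive in the first variable, with `P ⊥ Q`, `s(x,x) ≠ 0` for
non-zero `x` in `P` and in `Q`, such that every element of `𝔊` has an `s`-adjoint in `𝔊`. Then `𝔊 = End(W)` — the
classification-free replacement of Serre's lemma in Ribet's Theorem 3 at `(n′, n″) = (3, n″)`, `3 ∤ n″`.
[cite: Ribet1983, Thm. 3] [cite: Gordon1997, Thm. 6.3 (3) and pp. 18–19] [cite: Deligne1982HodgeCycles, I §3 Prop. 3.4, 3.6]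
[cite: MoonenZarhin1999LowDim, §2 (2.4) and Thm. (2.7)] -/
theorem UnitaryThreeCoprime.eq_top [FiniteDimensional ℂ W] {𝔊 : Submodule ℂ (Module.End ℂ W)}
    (hbr : ∀ Y ∈ 𝔊, ∀ Z ∈ 𝔊, Y * Z - Z * Y ∈ 𝔊)
    (hirr : ∀ U : Submodule ℂ W, (∀ A ∈ 𝔊, ∀ u ∈ U, A u ∈ U) → U = ⊥ ∨ U = ⊤)
    {Θ : Module.End ℂ W} (hΘ : Θ ∈ 𝔊) (hΘΘ : Θ * Θ = 1)
    {P Q : Submodule ℂ W} (hP : ∀ x, x ∈ P ↔ Θ x = x) (hQ : ∀ x, x ∈ Q ↔ Θ x = -x)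
    (hP3 : Module.finrank ℂ P = 3) (hQ3 : ¬ 3 ∣ Module.finrank ℂ Q)
    {s : W → W → ℂ} (hadd : ∀ x y z, s (x + y) z = s x z + s y z) (hsymm : ∀ x y, s y x = starRingEnd ℂ (s x y))
    (hPQ : ∀ p ∈ P, ∀ q ∈ Q, s p q = 0) (hdefP : ∀ p ∈ P, s p p = 0 → p = 0) (hdefQ : ∀ q ∈ Q, s q q = 0 → q = 0)
    (hadj : ∀ X ∈ 𝔊, ∃ Y ∈ 𝔊, ∀ x y, s (X x) y = s x (Y y)) : 𝔊 = ⊤ :=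
  UnitaryThreeCoprime.eq_top_aux _ hbr hirr hΘ hΘΘ hP hQ hP3 rfl hQ3 hadd hsymm hPQ hdefP hdefQ hadj

/-- **The symmetric statement: `3 ∤ dim P`, `dim Q = 3`** (apply `eq_top` to `−Θ`).
[cite: Ribet1983, Thm. 3] [cite: Gordon1997, Thm. 6.3 (3)] -/
theorem UnitaryThreeCoprime.eq_top' [FiniteDimensional ℂ W] {𝔊 : Submodule ℂ (Module.End ℂ W)}
    (hbr : ∀ Y ∈ 𝔊, ∀ Z ∈ 𝔊, Y * Z - Z * Y ∈ 𝔊)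
    (hirr : ∀ U : Submodule ℂ W, (∀ A ∈ 𝔊, ∀ u ∈ U, A u ∈ U) → U = ⊥ ∨ U = ⊤)
    {Θ : Module.End ℂ W} (hΘ : Θ ∈ 𝔊) (hΘΘ : Θ * Θ = 1)
    {P Q : Submodule ℂ W} (hP : ∀ x, x ∈ P ↔ Θ x = x) (hQ : ∀ x, x ∈ Q ↔ Θ x = -x)
    (hP3 : ¬ 3 ∣ Module.finrank ℂ P) (hQ3 : Module.finrank ℂ Q = 3)
    {s : W → W → ℂ} (hadd : ∀ x y z, s (x + y) z = s x z + s y z) (hsymm : ∀ x y, s y x = starRingEnd ℂ (s x y))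
    (hPQ : ∀ p ∈ P, ∀ q ∈ Q, s p q = 0) (hdefP : ∀ p ∈ P, s p p = 0 → p = 0) (hdefQ : ∀ q ∈ Q, s q q = 0 → q = 0)
    (hadj : ∀ X ∈ 𝔊, ∃ Y ∈ 𝔊, ∀ x y, s (X x) y = s x (Y y)) : 𝔊 = ⊤ := by
  have hnΘ : -Θ ∈ 𝔊 := Submodule.neg_mem _ hΘ
  have hnΘΘ : (-Θ) * (-Θ) = 1 := by rw [neg_mul_neg, hΘΘ]
  exact UnitaryThreeCoprime.eq_top hbr hirr hnΘ hnΘΘ (P := Q) (Q := P)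
    (fun x => by rw [hQ, LinearMap.neg_apply, neg_eq_iff_eq_neg]) (fun x => by rw [hP, LinearMap.neg_apply, neg_inj])
    hQ3 hP3 hadd hsymm (fun q hq p hp => by rw [hsymm, hPQ p hp q hq, map_zero]) hdefQ hdefP hadj

end Main

end HodgeStructure

end Literature.AlgebraicGeometry.Motives

end
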